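import Literature.MathematicalPhysics.KineticTheory.InfiniteChainSuperstableEstimates
import Mathlib.Topology.Baire.Lemmas
import Mathlib.Topology.Baire.CompleteMetrizable
import HarnessLib

/-!
# Buttà–Marchioro 2016, Theorem 2.1 (the dynamics on the superstable set `𝒳₀`, `d = ν = 1`): proof

Topic `Literature/MathematicalPhysics/KineticTheory`; second proofs-only companion of
`InfiniteChainSuperstableDynamics.lean` (after `InfiniteChainSuperstableEstimates.lean`, which holds
steps 1–3 below and is imported). It DISCHARGES the named fact
`OscillatorChain.ButtaMarchioro2016_thm21_chain` (P. Buttà, C. Marchioro, *Dynamics of infinite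
classical anharmonic crystals*, J. Stat. Phys. **164** (2016) 680–692 = arXiv:1602.01294, §2 Thm 2.1,
proof in §3, pp. 6–8) by the theorem `OscillatorChain.ButtaMarchioro2016_thm21_chain_holds`,
following the printed proof (§3) for the chain (`d = ν = 1`), in the tree's frame
(`OscillatorChain.IsSolution`, the severed flows `severedFlow` of LLL (9a)–(9c) as the partial
dynamics, `bmLocalEnergy = W_{μ,k}`, `bmGrowth = Q`, `bmGood = 𝒳₀`).

## The printed proof and its transcription

1. **Partial dynamics** (BM (3.1)–(3.2)). BM evolve the oscillators of the box `Λ_{μ,n}` with FREE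
   boundary conditions; we use the tree's severed flows `T^{Λ}_t` (particles outside `Λ` tied down,
   `InfiniteChainSevered.lean`, global existence `condB1_of_bddBelow` of
   `InfiniteChainDynamicsCondB1.lean`), for which the same estimates hold: the severed energy is
   conserved (`sevEnergy_eq_of_isSeveredSolution`, from `hasDerivWithinAt_sevEnergy`), whence
   `W_{μ,n}(T^{Λ_{μ,n}}_t x) ≤ 3 W_{μ,n+1}(x)` and the site/bond/displacement bounds
   (`severedFlow_energy_bounds`, `severedFlow_displacement_le`; BM (3.6)–(3.8); the factor `3`
   instead of BM's equality (3.6) accounts for the ordered-pair convention of (2.4) and is immaterial).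
2. **The iteration** (BM (3.3)–(3.9); Dobrushin–Fritz). `df_iterate`: for two curves solving the
   equations of motion in `Λ_{ν,n}`, `|Δq_i(s)| ≤ D Θ^d |s|^{2d}/(2d)!` at depth `d` (two-sided in
   time: `abs_le_of_deriv_two_bound`), with the force Lipschitz constant `Θ ≤ K₁ W^η`
   (`force_sub_force_le`, `exists_constants`: `η = (σ-1)/σ`, `σ = max{s₁,s₂}`, from the polynomial
   structure: `IsEvenPolyOfDegree.exists_deriv_bound`, `.exists_one_add_abs_pow_le`) and `D = 2t(2W)^{1/2}`
   (`df_iterate_energy`).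
3. **Summability** (BM (3.10)–(3.13)). `bm_arith`: with `(2d)! ≥ (2d/e)^{2d}` in place of Stirling,
   for `d ≥ A (1 + t²(1+t^{β'}) Q^γ)^{1/(2-γ)} L'` the iterated bound is `≤ 64^{-d}` (any fixed rate,
   by enlarging `A`); `consecutive_estimate`: `u^{μ,n}_k(t) ≤ 64^{-(n+1-k)}` and the momenta
   `≤ t K Q^η (2k + 2log(e+|μ|) + 7) 32^{-(n-k)}` for `n ≥ n_k^* = 2k + 2 + A X log(e+|μ|)`.
4. **The limit** (BM (3.3), (3.14)–(3.16)). `exists_limit_flow` (Cauchy in `n`, centre `0`),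
   `tendsto_severedFlow_cbox` (independence of the centre `μ`, by the iteration between
   `T^{Λ_{μ,n}}` and `T^{Λ_{0,n+|μ|}}`), `dist_limit_le` (rate), `isSolution_limit` (the limit
   solves (2.1): the tree's `isSolution_of_tendsto`, LLL Thm 1's passage to the limit).
5. **The growth estimate (2.7)** (end of §3). `growth_bound`: `W_{μ,k}(Φ_t x)` is compared with
   `W_{μ,k}(T^{Λ_{μ,n_k^*}}_t x) ≤ 3 W_{μ,n_k^*+1}(x) ≤ 3Q(x)(2n_k^*+3)` (`bmLocalEnergy_le_add`,
   `growth_main_le`), the error being `O(Q)` (`growth_err_le`; the momentum terms need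
   `t Q^{η-1/2} ≤ X`, `t_mul_rpow_le`, i.e. `2η - 1 < γ` — BM's (3.15)–(3.16) state `e^{-c n_k^*}`
   with a constant silently depending on `t`, `Q`; the honest bookkeeping is done here), and
   `X ≤ 4^{1/(2-γ)}[1 + t^{2/(2-γ)}(1+t^β)Q^{γ/(2-γ)}]` for `β' = (2-γ)β` (`scale_le_four_rpow_mul`).
   In particular `Φ_t(𝒳₀) ⊆ 𝒳₀` for all `t ∈ ℝ` (the estimates are symmetric in time).
6. **Uniqueness and the group law.** Thm 2.1 prints "one-parameter group … unique global solution"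
   without a uniqueness class and §3 argues neither; the fact's clause is uniqueness among global
   solutions WITH VALUES IN `𝒳₀` (see the statement file). We prove it in two steps:
   (a) `eq_of_isSolution_of_bmGrowth_le` — uniqueness among solutions with `Q` bounded on bounded
   time intervals (the same iteration, depth `→ ∞`; this is LLL 1977 Thm 2 / the argument BM use for
   the independence of `μ`), whence the group law `flow_add_of_bounds`;
   (b) a Baire-category upgrade (`good_everywhere`, `eq_flow_of_isSolution`): for a `𝒳₀`-valued
   solution `γ`, `Q ∘ γ` is the supremum of the continuous `W_{μ,k} ∘ γ /(2k+1)`, so its sublevel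
   sets are closed and cover `ℝ`; the (closed) set of times near which `Q ∘ γ` is unbounded, if
   non-empty, has a relatively open piece on which `Q ∘ γ ≤ N` (Baire); between such times `γ` is
   transported by `Φ` (local uniqueness (a) + group law + connectedness,
   `flow_eq_on_good_interval`), and (2.7) then bounds `Q ∘ γ` near a bad time — contradiction. So
   every time is good and `γ(t) = Φ_t(γ(0))` by (a) along `ℝ`.

Everything here is proved; no named facts, no new definitions. The axiom closure of
`ButtaMarchioro2016_thm21_chain_holds` is `{propext, Classical.choice, Quot.sound}`.

## Tree / Mathlib

Reused from the tree: `severedFlow`, `isSeveredSolution_severedFlow`, `severedFlow_zero`,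
`severedFlow_apply_of_not_mem` (`InfiniteChainSevered`); `sevEnergy`, `hasDerivWithinAt_sevEnergy`,
`sevBonds`, `condB1_of_bddBelow` (`InfiniteChainDynamicsCondB1`); `isSolution_of_tendsto`,
`sevGlue`, `sevField` (`InfiniteChainDynamicsProofs`); `IsSolution.comp_add_const`
(`InfiniteChainDynamics`); the estimates of `InfiniteChainSuperstableEstimates`. Mathlib:
`Convex.norm_image_sub_le_of_norm_hasDerivWithin_le`, `cauchySeq_of_le_geometric`, `dist_le_of_le_geometric_of_tendsto₀`,
`nonempty_interior_of_iUnion_of_closed`, `IsPreconnected.subset_of_closure_inter_subset`,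
`IsClosed.csSup_mem`.

## References

* P. Buttà, C. Marchioro, *Dynamics of infinite classical anharmonic crystals*, J. Stat. Phys. 164
  (2016) 680–692, doi:10.1007/s10955-016-1540-x, arXiv:1602.01294: §2 Thm 2.1, (2.3)–(2.7); §3
  (proof of Thm 2.1), eqs. (3.1)–(3.16). [ButtaMarchioro2016]
* O. E. Lanford III, J. L. Lebowitz, E. H. Lieb, *Time evolution of infinite anharmonic systems*,
  J. Stat. Phys. 16 (1977) 453–461: §2 (severed dynamics (9a)–(9c), proof of Thm 1), §3 Thm 2
  (uniqueness by the iteration). [LanfordLebowitzLieb1977]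
-/

noncomputable section

open MeasureTheory Filter Set Metric
open scoped Topology BigOperators

namespace Literature.MathematicalPhysics.KineticTheory.HeatConduction

namespace OscillatorChain

/-! ### §7 The limit flow (BM (3.3)): existence of the limit and independence of the centre -/

section Limit

variable {P : OscillatorChain} {s₁ s₂ : ℕ}

/-- `i ∈ Λ_{μ,|i-μ|}`. [folklore] -/
theorem mem_cbox_natAbs (μ i : ℤ) : i ∈ Finset.Icc (μ - ((i - μ).natAbs : ℕ)) (μ + ((i - μ).natAbs : ℕ)) := by
  rw [Finset.mem_Icc]; omega

/-- `Λ_{μ,r} ⊆ Λ_{0,r+|μ|}`. [folklore] -/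
theorem cbox_subset_cbox_zero (μ : ℤ) (r : ℕ) :
    Finset.Icc (μ - r) (μ + r) ⊆ Finset.Icc ((0 : ℤ) - (r + μ.natAbs : ℕ)) ((0 : ℤ) + (r + μ.natAbs : ℕ)) := by
  intro j hj
  rw [Finset.mem_Icc] at hj ⊢
  omega

/-- `log(e + |0|) = 1`. [folklore] -/
theorem log_exp_add_abs_zero : Real.log (Real.exp 1 + |((0 : ℤ) : ℝ)|) = 1 := by simp

/-- From the iterated position bound to the iterated momentum bound: for `s ≠ 0`,
`D Θ^d |s|^{2d-1}/(2d-1)! = (D Θ^d |s|^{2d}/(2d)!) · 2d/|s|`. [folklore] -/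
theorem iter_p_bound_of_q_bound {D Θ s B : ℝ} {d : ℕ} (hd : 1 ≤ d) (hs : s ≠ 0)
    (hB : D * Θ ^ d * |s| ^ (2 * d) / (2 * d).factorial ≤ B) :
    D * Θ ^ d * |s| ^ (2 * d - 1) / (2 * d - 1).factorial ≤ B * (2 * d) / |s| := by
  have hs0 : 0 < |s| := abs_pos.2 hs
  obtain ⟨m, rfl⟩ : ∃ m, d = m + 1 := ⟨d - 1, by omega⟩
  have e1 : 2 * (m + 1) - 1 = 2 * m + 1 := by omega
  have e2 : 2 * (m + 1) = 2 * m + 1 + 1 := by omega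
  rw [e1]
  rw [e2] at hB
  have hfac : ((2 * m + 1 + 1).factorial : ℝ) = (2 * m + 1).factorial * (2 * m + 1 + 1 : ℕ) := by
    rw [Nat.factorial_succ]; push_cast; ring
  have hpow : |s| ^ (2 * m + 1 + 1) = |s| ^ (2 * m + 1) * |s| := pow_succ _ _
  have hf0 : (0 : ℝ) < (2 * m + 1).factorial := by positivity
  have hd0 : (0 : ℝ) < 2 * ((m + 1 : ℕ) : ℝ) := by positivity
  have key : D * Θ ^ (m + 1) * |s| ^ (2 * m + 1) / (2 * m + 1).factorial =
      (D * Θ ^ (m + 1) * |s| ^ (2 * m + 1 + 1) / (2 * m + 1 + 1).factorial) *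
        (2 * ((m + 1 : ℕ) : ℝ)) / |s| := by
    rw [hfac, hpow]
    push_cast
    field_simp
    ring
  rw [key]
  exact div_le_div_of_nonneg_right (mul_le_mul_of_nonneg_right hB hd0.le) hs0.le

/-- **Existence of the limit (3.3)** (centre `μ = 0`): for `x ∈ 𝒳₀`, every `s` and every site `i`
the severed orbits `T^{Λ_{0,n}}_s x (i)` converge as `n → ∞`; the limit defines `Φ_s(x)_i`
(elsewhere `Φ` is arbitrary). The sequence is Cauchy by `consecutive_estimate` (geometric tails).
[cite: ButtaMarchioro2016, §3 eq. (3.3) and after eq. (3.13)] -/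
theorem exists_limit_flow (hs₁ : 1 ≤ s₁) (hs₂ : 1 ≤ s₂) (hU1 : IsEvenPolyOfDegree P.U s₁)
    (hV1 : IsEvenPolyOfDegree P.V s₂) (hB1 : P.CondB1) :
    ∃ Φ : ℝ → ChainConfig → ChainConfig, ∀ x ∈ P.bmGood, ∀ (s : ℝ) (i : ℤ),
      Tendsto (fun n : ℕ => severedFlow hB1 (Finset.Icc ((0 : ℤ) - n) ((0 : ℤ) + n)) s x i) atTop
        (𝓝 (Φ s x i)) := by
  have hU0 : ∀ r, 0 ≤ P.U r := hU1.choose_spec.2.2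
  have hV0 : ∀ r, 0 ≤ P.V r := hV1.choose_spec.2.2
  set η : ℝ := (((max s₁ s₂ : ℕ) : ℝ) - 1) / ((max s₁ s₂ : ℕ) : ℝ) with hη
  have hS1 : (1 : ℝ) ≤ ((max s₁ s₂ : ℕ) : ℝ) := by exact_mod_cast le_max_of_le_left hs₁
  have hS0 : (0 : ℝ) < ((max s₁ s₂ : ℕ) : ℝ) := by linarith
  have hη1 : η < 2 := by
    have : η ≤ 1 := by rw [hη, div_le_one hS0]; linarith
    linarith
  set γ₀ : ℝ := (η + 2) / 2 with hγ₀
  have hγ : η < γ₀ := by rw [hγ₀]; linarith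
  have hγ2 : γ₀ < 2 := by rw [hγ₀]; linarith
  obtain ⟨A, K, hA1, hK0, hce⟩ := consecutive_estimate hs₁ hs₂ hU1 hV1 hB1 hγ hγ2 one_pos
  refine ⟨fun s x i => limUnder atTop
    (fun n : ℕ => severedFlow hB1 (Finset.Icc ((0 : ℤ) - n) ((0 : ℤ) + n)) s x i), ?_⟩
  intro x hx s i
  apply tendsto_nhds_limUnder
  set f : ℕ → ℝ × ℝ := fun n => severedFlow hB1 (Finset.Icc ((0 : ℤ) - n) ((0 : ℤ) + n)) s x i with hf
  -- the site `i` lies in `Λ_{0,k}`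
  set k : ℕ := (i - 0).natAbs with hk
  have hi : i ∈ Finset.Icc ((0 : ℤ) - k) ((0 : ℤ) + k) := mem_cbox_natAbs 0 i
  set Q := P.bmGrowth x with hQ
  set L₀ := Real.log (Real.exp 1 + |((0 : ℤ) : ℝ)|) with hL₀
  have hL₀1 : L₀ = 1 := log_exp_add_abs_zero
  set X := (1 + |s| ^ 2 * (1 + |s| ^ (1 : ℝ)) * Q ^ γ₀) ^ (1 / (2 - γ₀)) with hX
  set N₀ : ℕ := ⌈2 * (k : ℝ) + 2 + A * X * L₀⌉₊ with hN₀
  have hN₀ge : 2 * (k : ℝ) + 2 + A * X * L₀ ≤ N₀ := Nat.le_ceil _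
  have hQ1 : 1 ≤ Q := one_le_bmGrowth hU0 hV0 hx
  have hQ0 : 0 ≤ Q := zero_le_one.trans hQ1
  have hX0 : 0 ≤ X := by rw [hX]; exact Real.rpow_nonneg (by positivity) _
  have hAXL : 0 ≤ A * X * L₀ := by
    rw [hL₀1]; have : 0 ≤ A := zero_le_one.trans hA1; positivity
  have hkN : k ≤ N₀ := by
    have : (k : ℝ) ≤ N₀ := by linarith
    exact_mod_cast this
  -- the shifted sequence has geometrically decaying increments
  set B : ℝ := 1 + |s| * K * Q ^ η * (2 * k + 2 * L₀ + 7) with hB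
  have hQη : 0 ≤ Q ^ η := Real.rpow_nonneg hQ0 η
  have hB1' : 1 ≤ B := by
    rw [hB, hL₀1]
    have : 0 ≤ |s| * K * Q ^ η * (2 * k + 2 * 1 + 7) := by positivity
    linarith
  set g : ℕ → ℝ × ℝ := fun m => f (N₀ + m) with hg
  have hstep : ∀ m : ℕ, dist (g m) (g (m + 1)) ≤ B * (1 / 2) ^ m := by
    intro m
    have hn : 2 * (k : ℝ) + 2 + A * X * L₀ ≤ ((N₀ + m : ℕ) : ℝ) := by
      push_cast; linarith
    have h := hce x hx 0 |s| (abs_nonneg s) k (N₀ + m) hn i hi s le_rfl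
    obtain ⟨hq, hp⟩ := h
    have h64 : ((1 : ℝ) / 64) ^ (N₀ + m + 1 - k) ≤ (1 / 2) ^ m :=
      calc ((1 : ℝ) / 64) ^ (N₀ + m + 1 - k) ≤ (1 / 64) ^ m :=
            pow_le_pow_of_le_one (by norm_num) (by norm_num) (by omega)
        _ ≤ (1 / 2) ^ m := pow_le_pow_left₀ (by norm_num) (by norm_num) m
    have h32 : ((1 : ℝ) / 32) ^ (N₀ + m - k) ≤ (1 / 2) ^ m :=
      calc ((1 : ℝ) / 32) ^ (N₀ + m - k) ≤ (1 / 32) ^ m :=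
            pow_le_pow_of_le_one (by norm_num) (by norm_num) (by omega)
        _ ≤ (1 / 2) ^ m := pow_le_pow_left₀ (by norm_num) (by norm_num) m
    have h2m : (0 : ℝ) ≤ (1 / 2) ^ m := by positivity
    rw [Prod.dist_eq, Real.dist_eq, Real.dist_eq, abs_sub_comm ((g m).1), abs_sub_comm ((g m).2)]
    refine max_le ?_ ?_
    · calc |(g (m + 1)).1 - (g m).1| ≤ (1 / 64) ^ (N₀ + m + 1 - k) := hq
        _ ≤ (1 / 2) ^ m := h64
        _ ≤ B * (1 / 2) ^ m := le_mul_of_one_le_left h2m hB1'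
    · calc |(g (m + 1)).2 - (g m).2|
          ≤ |s| * K * P.bmGrowth x ^ η * (2 * k + 2 * Real.log (Real.exp 1 + |((0 : ℤ) : ℝ)|) + 7) *
              (1 / 32) ^ (N₀ + m - k) := hp
        _ ≤ |s| * K * Q ^ η * (2 * k + 2 * L₀ + 7) * (1 / 2) ^ m := by
            rw [← hQ, ← hL₀]
            refine mul_le_mul_of_nonneg_left h32 ?_
            rw [hL₀1]; positivity
        _ ≤ B * (1 / 2) ^ m := by
            refine mul_le_mul_of_nonneg_right ?_ h2m
            rw [hB]; linarith
  have hcauchy : CauchySeq g := cauchySeq_of_le_geometric (1 / 2) B (by norm_num) hstep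
  obtain ⟨a, ha⟩ := cauchySeq_tendsto_of_complete hcauchy
  refine ⟨a, ?_⟩
  have hg' : g = fun m => f (m + N₀) := by funext m; simp [hg, add_comm]
  rw [hg'] at ha
  exact (tendsto_add_atTop_iff_nat N₀).1 ha

/-- `C ((1/64)^{n-k} + (n-k)(1/64)^{n-k}) → 0`. [folklore] -/
theorem tendsto_geom_aux (C : ℝ) (k : ℕ) :
    Tendsto (fun n : ℕ => C * (((1 : ℝ) / 64) ^ (n - k) + ((n - k : ℕ) : ℝ) * (1 / 64) ^ (n - k)))
      atTop (𝓝 0) := by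
  have h1 : Tendsto (fun m : ℕ => ((1 : ℝ) / 64) ^ m) atTop (𝓝 0) :=
    tendsto_pow_atTop_nhds_zero_of_lt_one (by norm_num) (by norm_num)
  have h2 : Tendsto (fun m : ℕ => (m : ℝ) * ((1 : ℝ) / 64) ^ m) atTop (𝓝 0) :=
    tendsto_self_mul_const_pow_of_lt_one (by norm_num) (by norm_num)
  have h3 := (h1.add h2).comp (tendsto_sub_atTop_nat k)
  rw [add_zero] at h3
  have h4 := h3.const_mul C
  rw [mul_zero] at h4
  exact h4

/-- **Independence of the centre** (BM §3, the paragraph "It remains to prove that the limit … is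
independent of the choice of `μ`"): for `x ∈ 𝒳₀` the severed orbits in the boxes `Λ_{μ,n}` converge,
for every centre `μ`, to the same limit `Φ_s(x)_i` (comparison of `T^{Λ_{μ,n}}` with
`T^{Λ_{0,n+|μ|}}` by the iteration, whose depth at `i` tends to infinity).
[cite: ButtaMarchioro2016, §3 (independence of μ)] -/
theorem tendsto_severedFlow_cbox (hs₁ : 1 ≤ s₁) (hs₂ : 1 ≤ s₂) (hU1 : IsEvenPolyOfDegree P.U s₁)
    (hV1 : IsEvenPolyOfDegree P.V s₂) (hB1 : P.CondB1) {Φ : ℝ → ChainConfig → ChainConfig}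
    (hΦ : ∀ x ∈ P.bmGood, ∀ (s : ℝ) (i : ℤ),
      Tendsto (fun n : ℕ => severedFlow hB1 (Finset.Icc ((0 : ℤ) - n) ((0 : ℤ) + n)) s x i) atTop
        (𝓝 (Φ s x i)))
    {x : ChainConfig} (hx : x ∈ P.bmGood) (μ : ℤ) (s : ℝ) (i : ℤ) :
    Tendsto (fun n : ℕ => severedFlow hB1 (Finset.Icc (μ - n) (μ + n)) s x i) atTop (𝓝 (Φ s x i)) := by
  by_cases hs0 : s = 0
  · subst hs0
    have h := hΦ x hx 0 i
    simp only [severedFlow_zero] at h ⊢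
    exact h
  have hU : ContDiff ℝ 2 P.U := hU1.contDiff_two
  have hV : ContDiff ℝ 2 P.V := hV1.contDiff_two
  have hU0 : ∀ r, 0 ≤ P.U r := hU1.choose_spec.2.2
  have hV0 : ∀ r, 0 ≤ P.V r := hV1.choose_spec.2.2
  have hVe : ∀ r, P.V (-r) = P.V r := fun r => congrFun hV1.comp_neg r
  obtain ⟨K₁, K₂, hK₁0, hK₂1, hLipF, -, -, -, -⟩ := exists_constants hs₁ hs₂ hU1 hV1
  set η : ℝ := (((max s₁ s₂ : ℕ) : ℝ) - 1) / ((max s₁ s₂ : ℕ) : ℝ) with hη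
  have hS1 : (1 : ℝ) ≤ ((max s₁ s₂ : ℕ) : ℝ) := by exact_mod_cast le_max_of_le_left hs₁
  have hS0 : (0 : ℝ) < ((max s₁ s₂ : ℕ) : ℝ) := by linarith
  have hη1 : η ≤ 1 := by rw [hη, div_le_one hS0]; linarith
  have hη0 : 0 ≤ η := by rw [hη]; exact div_nonneg (by linarith) hS0.le
  set γ₀ : ℝ := (η + 2) / 2 with hγ₀
  have hγ : η < γ₀ := by rw [hγ₀]; linarith
  have hγ2 : γ₀ < 2 := by rw [hγ₀]; linarith
  obtain ⟨A, hA1, hA⟩ := bm_arith hK₁0 hη0 hγ hγ2 one_pos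
  -- notation
  set M : ℕ := μ.natAbs with hM
  set k : ℕ := (i - μ).natAbs with hk
  have hi : i ∈ Finset.Icc (μ - k) (μ + k) := mem_cbox_natAbs μ i
  set Q := P.bmGrowth x with hQ
  set L := Real.log (Real.exp 1 + |(μ : ℝ)|) with hL
  have hQ1 : 1 ≤ Q := one_le_bmGrowth hU0 hV0 hx
  have hQ0 : 0 ≤ Q := zero_le_one.trans hQ1
  have hL1 : 1 ≤ L := one_le_log_exp_add_abs μ
  set L' : ℝ := k + M + L + 1 with hL'
  have hL'1 : 1 ≤ L' := by
    have hk0 : (0 : ℝ) ≤ k := Nat.cast_nonneg k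
    have hM0 : (0 : ℝ) ≤ M := Nat.cast_nonneg M
    rw [hL']; linarith
  set t : ℝ := |s| with ht
  have ht0 : 0 < t := abs_pos.2 hs0
  set X := (1 + t ^ 2 * (1 + t ^ (1 : ℝ)) * Q ^ γ₀) ^ (1 / (2 - γ₀)) with hX
  have hX0 : 0 ≤ X := by rw [hX]; exact Real.rpow_nonneg (by positivity) _
  have hAXL : 0 ≤ A * X * L' := by
    have : 0 ≤ A := zero_le_one.trans hA1
    have : 0 ≤ L' := zero_le_one.trans hL'1
    positivity
  set n₁ : ℕ := ⌈A * X * L'⌉₊ + k with hn₁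
  -- the two flows to compare, at stage `n`
  set T₀ : ℕ → ℝ × ℝ := fun n =>
    severedFlow hB1 (Finset.Icc ((0 : ℤ) - (n + M : ℕ)) ((0 : ℤ) + (n + M : ℕ))) s x i with hT₀
  set Tμ : ℕ → ℝ × ℝ := fun n => severedFlow hB1 (Finset.Icc (μ - n) (μ + n)) s x i with hTμ
  -- the main estimate
  have hmain : ∀ n : ℕ, n₁ ≤ n →
      ‖Tμ n - T₀ n‖ ≤ (1 + 2 / t) * ((1 / 64) ^ (n - k) + ((n - k : ℕ) : ℝ) * (1 / 64) ^ (n - k)) := by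
    intro n hn
    have hkn : k ≤ n := le_trans (Nat.le_add_left k _) hn
    have hceil : A * X * L' ≤ (⌈A * X * L'⌉₊ : ℝ) := Nat.le_ceil _
    have hdn : A * X * L' ≤ ((n + 1 - k : ℕ) : ℝ) := by
      have h1 : ((⌈A * X * L'⌉₊ + k : ℕ) : ℝ) ≤ n := by exact_mod_cast hn
      push_cast at h1
      rw [Nat.cast_sub (by omega)]; push_cast; linarith
    set d : ℕ := n + 1 - k with hd
    have hd1 : 1 ≤ d := by omega
    have hkd : k + d = n + 1 := by omega
    -- the energy level
    set Y : ℝ := P.bmLocalEnergy 0 (n + M + 1) x + P.bmLocalEnergy μ (n + 1) x with hY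
    have hW0 : 1 ≤ P.bmLocalEnergy 0 (n + M + 1) x := one_le_bmLocalEnergy hU0 hV0 0 _ x
    have hWμ : 1 ≤ P.bmLocalEnergy μ (n + 1) x := one_le_bmLocalEnergy hU0 hV0 μ _ x
    have hY1 : 1 ≤ Y := by rw [hY]; linarith
    have hY0le : P.bmLocalEnergy 0 (n + M + 1) x ≤ Y := by rw [hY]; linarith
    have hYμle : P.bmLocalEnergy μ (n + 1) x ≤ Y := by rw [hY]; linarith
    have hYle : Y ≤ 18 * Q * (d + L') := by
      have h0 := bmLocalEnergy_le hU0 hV0 hx 0 (n + M + 1)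
      rw [log_exp_add_abs_zero] at h0
      have hμ' := bmLocalEnergy_le hU0 hV0 hx μ (n + 1)
      have hnd : (n : ℝ) = d + k - 1 := by
        rw [hd, Nat.cast_sub (by omega)]; push_cast; ring
      push_cast at h0 hμ'
      rw [hY, hL']
      have hk0 : (0 : ℝ) ≤ k := Nat.cast_nonneg k
      have hM0 : (0 : ℝ) ≤ M := Nat.cast_nonneg M
      nlinarith
    -- energy-format bounds for both flows
    have hsol₀ := isSeveredSolution_severedFlow hB1
      (Finset.Icc ((0 : ℤ) - (n + M : ℕ)) ((0 : ℤ) + (n + M : ℕ))) x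
    have hsolμ := isSeveredSolution_severedFlow hB1 (Finset.Icc (μ - n) (μ + n)) x
    have key := df_iterate_energy (K₁ := K₁) (η := η) hLipF (x := x) (μ := μ) (n := n) (t := t) hY1
      (γ₁ := fun r => severedFlow hB1 (Finset.Icc ((0 : ℤ) - (n + M : ℕ)) ((0 : ℤ) + (n + M : ℕ))) r x)
      (γ₂ := fun r => severedFlow hB1 (Finset.Icc (μ - n) (μ + n)) r x)
      (fun j hj r => hsol₀.1 j (cbox_subset_cbox_zero μ n hj) r)
      (fun j hj r => hsolμ.1 j hj r)
      (fun j _ => by simp) (fun j _ => by simp)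
      (fun r hr j hj => by
        have hf := (severedFlow_energy_format hU hV hU0 hV0 hVe hB1 0 (n + M) x hY0le r).1
        refine hf j ?_
        rw [Finset.mem_Icc] at hj ⊢; omega)
      (fun r hr j hj => (severedFlow_energy_format hU hV hU0 hV0 hVe hB1 μ n x hYμle r).1 j hj)
      (fun r hr j hj => by
        have hf := (severedFlow_energy_format hU hV hU0 hV0 hVe hB1 0 (n + M) x hY0le r).2.1
        refine hf j ?_
        rw [Finset.mem_Icc] at hj ⊢; omega)
      (fun r hr j hj => (severedFlow_energy_format hU hV hU0 hV0 hVe hB1 μ n x hYμle r).2.1 j hj)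
      (fun r hr j hj => by
        have hf := (severedFlow_energy_format hU hV hU0 hV0 hVe hB1 0 (n + M) x hY0le r).2.2.1
        have hj' : j ∈ Finset.Icc ((0 : ℤ) - (n + M + 1 : ℕ)) ((0 : ℤ) + (n + M + 1 : ℕ)) := by
          rw [Finset.mem_Icc] at hj ⊢; omega
        calc |(severedFlow hB1 (Finset.Icc ((0 : ℤ) - (n + M : ℕ)) ((0 : ℤ) + (n + M : ℕ))) r x j).1 -
              (x j).1| ≤ |r| * Real.sqrt (2 * Y) := hf j hj'
          _ ≤ t * Real.sqrt (2 * Y) := mul_le_mul_of_nonneg_right hr (Real.sqrt_nonneg _))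
      (fun r hr j hj => by
        have hf := (severedFlow_energy_format hU hV hU0 hV0 hVe hB1 μ n x hYμle r).2.2.1
        calc |(severedFlow hB1 (Finset.Icc (μ - n) (μ + n)) r x j).1 - (x j).1|
            ≤ |r| * Real.sqrt (2 * Y) := hf j hj
          _ ≤ t * Real.sqrt (2 * Y) := mul_le_mul_of_nonneg_right hr (Real.sqrt_nonneg _))
      d k hkd i hi s le_rfl
    obtain ⟨hq, hp⟩ := key
    have hp := hp hd1
    -- the arithmetic
    have harith := hA Q L' t Y d hQ1 hL'1 ht0.le hY1 hYle hdn
    have hq' : |(severedFlow hB1 (Finset.Icc ((0 : ℤ) - (n + M : ℕ)) ((0 : ℤ) + (n + M : ℕ))) s x i).1 -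
        (severedFlow hB1 (Finset.Icc (μ - n) (μ + n)) s x i).1| ≤ (1 / 64) ^ d := hq.trans harith
    have hp' : |(severedFlow hB1 (Finset.Icc ((0 : ℤ) - (n + M : ℕ)) ((0 : ℤ) + (n + M : ℕ))) s x i).2 -
        (severedFlow hB1 (Finset.Icc (μ - n) (μ + n)) s x i).2| ≤ (1 / 64) ^ d * (2 * d) / |s| :=
      hp.trans (iter_p_bound_of_q_bound hd1 hs0 harith)
    -- conversion to the stated majorant
    have hdk : d = (n - k) + 1 := by omega
    have h64 : ((1 : ℝ) / 64) ^ d ≤ (1 / 64) ^ (n - k) :=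
      pow_le_pow_of_le_one (by norm_num) (by norm_num) (by omega)
    have hpos : (0 : ℝ) ≤ (1 / 64) ^ (n - k) := by positivity
    have hnk0 : (0 : ℝ) ≤ ((n - k : ℕ) : ℝ) := Nat.cast_nonneg _
    set S : ℝ := (1 / 64) ^ (n - k) + ((n - k : ℕ) : ℝ) * (1 / 64) ^ (n - k) with hS
    have hSnn : 0 ≤ S := by rw [hS]; positivity
    have h2t : 0 ≤ 2 / t := by positivity
    have hdcast : (d : ℝ) = ((n - k : ℕ) : ℝ) + 1 := by rw [hdk]; push_cast; ring
    rw [norm_sub_rev, Prod.norm_def, Real.norm_eq_abs, Real.norm_eq_abs]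
    refine max_le ?_ ?_
    · calc |(T₀ n).1 - (Tμ n).1| ≤ (1 / 64) ^ d := hq'
        _ ≤ (1 / 64) ^ (n - k) := h64
        _ ≤ S := by rw [hS]; exact le_add_of_nonneg_right (by positivity)
        _ = 1 * S := (one_mul S).symm
        _ ≤ (1 + 2 / t) * S := mul_le_mul_of_nonneg_right (by linarith) hSnn
    · calc |(T₀ n).2 - (Tμ n).2| ≤ (1 / 64) ^ d * (2 * d) / |s| := hp'
        _ ≤ (1 / 64) ^ (n - k) * (2 * (((n - k : ℕ) : ℝ) + 1)) / |s| := by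
            refine div_le_div_of_nonneg_right ?_ (abs_nonneg s)
            rw [hdcast]
            exact mul_le_mul_of_nonneg_right h64 (by positivity)
        _ = (2 / t) * S := by
            rw [hS, ht]
            field_simp
            ring
        _ ≤ (1 + 2 / t) * S := mul_le_mul_of_nonneg_right (by linarith) hSnn
  -- conclusion
  have hdiff : Tendsto (fun n => Tμ n - T₀ n) atTop (𝓝 0) := by
    refine squeeze_zero_norm' ?_ (tendsto_geom_aux (1 + 2 / t) k)
    exact eventually_atTop.2 ⟨n₁, hmain⟩
  have hT₀ : Tendsto T₀ atTop (𝓝 (Φ s x i)) := (hΦ x hx s i).comp (tendsto_add_atTop_nat M)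
  have h := hdiff.add hT₀
  rw [zero_add] at h
  have he : (fun n => Tμ n - T₀ n + T₀ n) = Tμ := by funext n; simp
  rwa [he] at h

/-- **Rate of convergence to the limit** (BM (3.14)–(3.16), with the honest prefactors): under
the hypotheses of `consecutive_estimate` (same `A`, `K`), for `n ≥ n_k^*` the limit is within
`2·64^{-(n+1-k)}` of `q^{μ,n}_i(s)` and within `2 t K Q^η (2k + 2log(e+|μ|) + 7) 32^{-(n-k)}` of
`p^{μ,n}_i(s)`, for all `i ∈ Λ_{μ,k}`, `|s| ≤ t`. [cite: ButtaMarchioro2016, §3 eqs. (3.14)–(3.16)] -/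
theorem dist_limit_le (hs₁ : 1 ≤ s₁) (hs₂ : 1 ≤ s₂) (hU1 : IsEvenPolyOfDegree P.U s₁)
    (hV1 : IsEvenPolyOfDegree P.V s₂) (hB1 : P.CondB1) {Φ : ℝ → ChainConfig → ChainConfig}
    (hΦ : ∀ x ∈ P.bmGood, ∀ (s : ℝ) (i : ℤ),
      Tendsto (fun n : ℕ => severedFlow hB1 (Finset.Icc ((0 : ℤ) - n) ((0 : ℤ) + n)) s x i) atTop
        (𝓝 (Φ s x i)))
    {γ β' : ℝ} (hγ : (((max s₁ s₂ : ℕ) : ℝ) - 1) / ((max s₁ s₂ : ℕ) : ℝ) < γ) (hγ2 : γ < 2)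
    (hβ' : 0 < β') :
    ∃ A K : ℝ, 1 ≤ A ∧ 0 ≤ K ∧ ∀ x ∈ P.bmGood, ∀ (μ : ℤ) (t : ℝ), 0 ≤ t → ∀ (k n : ℕ),
      2 * (k : ℝ) + 2 + A * (1 + t ^ 2 * (1 + t ^ β') * P.bmGrowth x ^ γ) ^ (1 / (2 - γ)) *
        Real.log (Real.exp 1 + |(μ : ℝ)|) ≤ n →
      ∀ i ∈ Finset.Icc (μ - k) (μ + k), ∀ s : ℝ, |s| ≤ t →
        |(Φ s x i).1 - (severedFlow hB1 (Finset.Icc (μ - n) (μ + n)) s x i).1| ≤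
            2 * (1 / 64) ^ (n + 1 - k) ∧
        |(Φ s x i).2 - (severedFlow hB1 (Finset.Icc (μ - n) (μ + n)) s x i).2| ≤
          2 * (t * K * P.bmGrowth x ^ ((((max s₁ s₂ : ℕ) : ℝ) - 1) / ((max s₁ s₂ : ℕ) : ℝ)) *
            (2 * k + 2 * Real.log (Real.exp 1 + |(μ : ℝ)|) + 7) * (1 / 32) ^ (n - k)) := by
  obtain ⟨A, K, hA1, hK0, hce⟩ := consecutive_estimate hs₁ hs₂ hU1 hV1 hB1 hγ hγ2 hβ'
  refine ⟨A, K, hA1, hK0, ?_⟩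
  intro x hx μ t ht k n hn i hi s hs
  set η : ℝ := (((max s₁ s₂ : ℕ) : ℝ) - 1) / ((max s₁ s₂ : ℕ) : ℝ) with hη
  have hU0 : ∀ r, 0 ≤ P.U r := hU1.choose_spec.2.2
  have hV0 : ∀ r, 0 ≤ P.V r := hV1.choose_spec.2.2
  have hQ0 : 0 ≤ P.bmGrowth x := zero_le_one.trans (one_le_bmGrowth hU0 hV0 hx)
  have hL1 : 1 ≤ Real.log (Real.exp 1 + |(μ : ℝ)|) := one_le_log_exp_add_abs μ
  have hkn : k ≤ n := by
    have hX : 0 ≤ A * (1 + t ^ 2 * (1 + t ^ β') * P.bmGrowth x ^ γ) ^ (1 / (2 - γ)) *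
        Real.log (Real.exp 1 + |(μ : ℝ)|) := by
      have : 0 ≤ A := zero_le_one.trans hA1
      have : 0 ≤ (1 + t ^ 2 * (1 + t ^ β') * P.bmGrowth x ^ γ) ^ (1 / (2 - γ)) :=
        Real.rpow_nonneg (by positivity) _
      positivity
    have : (k : ℝ) ≤ n := by linarith
    exact_mod_cast this
  -- the sequence `m ↦ T^{μ,n+m}_s x i` and its limit
  set g : ℕ → ℝ × ℝ := fun m => severedFlow hB1 (Finset.Icc (μ - (n + m : ℕ)) (μ + (n + m : ℕ))) s x i
    with hg
  have hglim : Tendsto g atTop (𝓝 (Φ s x i)) := by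
    have h := (tendsto_severedFlow_cbox hs₁ hs₂ hU1 hV1 hB1 hΦ hx μ s i).comp (tendsto_add_atTop_nat n)
    have he : g = (fun n' : ℕ => severedFlow hB1 (Finset.Icc (μ - n') (μ + n')) s x i) ∘ fun m => m + n := by
      funext m; simp [hg, add_comm]
    rw [he]; exact h
  have hg1 : Tendsto (fun m => (g m).1) atTop (𝓝 (Φ s x i).1) := hglim.fst_nhds
  have hg2 : Tendsto (fun m => (g m).2) atTop (𝓝 (Φ s x i).2) := hglim.snd_nhds
  -- consecutive bounds along the sequence
  set Cq : ℝ := (1 / 64) ^ (n + 1 - k) with hCq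
  set Cp : ℝ := t * K * P.bmGrowth x ^ η * (2 * k + 2 * Real.log (Real.exp 1 + |(μ : ℝ)|) + 7) *
    (1 / 32) ^ (n - k) with hCp
  have hstep : ∀ m : ℕ, dist (g m).1 (g (m + 1)).1 ≤ Cq * (1 / 64) ^ m ∧
      dist (g m).2 (g (m + 1)).2 ≤ Cp * (1 / 32) ^ m := by
    intro m
    have hnm : 2 * (k : ℝ) + 2 + A * (1 + t ^ 2 * (1 + t ^ β') * P.bmGrowth x ^ γ) ^ (1 / (2 - γ)) *
        Real.log (Real.exp 1 + |(μ : ℝ)|) ≤ ((n + m : ℕ) : ℝ) := by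
      push_cast; have : (0 : ℝ) ≤ m := Nat.cast_nonneg m; linarith
    obtain ⟨hq, hp⟩ := hce x hx μ t ht k (n + m) hnm i hi s hs
    rw [Real.dist_eq, Real.dist_eq, abs_sub_comm ((g m).1), abs_sub_comm ((g m).2)]
    have e1 : n + m + 1 - k = (n + 1 - k) + m := by omega
    have e2 : n + m - k = (n - k) + m := by omega
    rw [e1, pow_add] at hq
    rw [e2, pow_add] at hp
    refine ⟨hq.trans (le_of_eq (by rw [hCq])), hp.trans (le_of_eq (by rw [hCp, hη]; ring))⟩
  have hq := dist_le_of_le_geometric_of_tendsto₀ (1 / 64) Cq (by norm_num) (fun m => (hstep m).1) hg1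
  have hp := dist_le_of_le_geometric_of_tendsto₀ (1 / 32) Cp (by norm_num) (fun m => (hstep m).2) hg2
  have hg0 : g 0 = severedFlow hB1 (Finset.Icc (μ - n) (μ + n)) s x i := by simp [hg]
  rw [hg0, Real.dist_eq, abs_sub_comm] at hq hp
  have hCq0 : 0 ≤ Cq := by positivity
  have hCp0 : 0 ≤ Cp := by
    have : 0 ≤ P.bmGrowth x ^ η := Real.rpow_nonneg hQ0 η
    positivity
  refine ⟨hq.trans ?_, hp.trans ?_⟩
  · rw [div_le_iff₀ (by norm_num)]; nlinarith
  · rw [div_le_iff₀ (by norm_num)]; nlinarith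

/-- **The limit orbit solves the equations of motion (2.1)** for `x ∈ 𝒳₀` (BM: "which in turn
shows not only the existence of the limit … but also that it is solution to (2.1)"): the severed
orbits in the boxes `Λ_{0,n}` converge pointwise, are bounded on bounded time intervals uniformly in
`n` (energy bounds up to the index `n_k^*`, the convergence rate beyond), and eventually solve the
`j`-th pair of equations; the tree's `isSolution_of_tendsto` (passage to the limit of LLL Thm 1)
concludes. [cite: ButtaMarchioro2016, §3 (after eq. (3.13))] -/
theorem isSolution_limit (hs₁ : 1 ≤ s₁) (hs₂ : 1 ≤ s₂) (hU1 : IsEvenPolyOfDegree P.U s₁)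
    (hV1 : IsEvenPolyOfDegree P.V s₂) (hB1 : P.CondB1) {Φ : ℝ → ChainConfig → ChainConfig}
    (hΦ : ∀ x ∈ P.bmGood, ∀ (s : ℝ) (i : ℤ),
      Tendsto (fun n : ℕ => severedFlow hB1 (Finset.Icc ((0 : ℤ) - n) ((0 : ℤ) + n)) s x i) atTop
        (𝓝 (Φ s x i)))
    {x : ChainConfig} (hx : x ∈ P.bmGood) : P.IsSolution fun s => Φ s x := by
  have hU : ContDiff ℝ 2 P.U := hU1.contDiff_two
  have hV : ContDiff ℝ 2 P.V := hV1.contDiff_two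
  have hU0 : ∀ r, 0 ≤ P.U r := hU1.choose_spec.2.2
  have hV0 : ∀ r, 0 ≤ P.V r := hV1.choose_spec.2.2
  have hVe : ∀ r, P.V (-r) = P.V r := fun r => congrFun hV1.comp_neg r
  have hUc : Continuous (deriv P.U) := hU.continuous_deriv (by norm_num)
  have hVc : Continuous (deriv P.V) := hV.continuous_deriv (by norm_num)
  set η : ℝ := (((max s₁ s₂ : ℕ) : ℝ) - 1) / ((max s₁ s₂ : ℕ) : ℝ) with hη
  have hS1 : (1 : ℝ) ≤ ((max s₁ s₂ : ℕ) : ℝ) := by exact_mod_cast le_max_of_le_left hs₁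
  have hS0 : (0 : ℝ) < ((max s₁ s₂ : ℕ) : ℝ) := by linarith
  have hη2 : η < 2 := by
    have : η ≤ 1 := by rw [hη, div_le_one hS0]; linarith
    linarith
  set γ₀ : ℝ := (η + 2) / 2 with hγ₀
  have hγ : η < γ₀ := by rw [hγ₀]; linarith
  have hγ2 : γ₀ < 2 := by rw [hγ₀]; linarith
  obtain ⟨A, K, hA1, hK0, hrate⟩ := dist_limit_le hs₁ hs₂ hU1 hV1 hB1 hΦ hγ hγ2 one_pos
  set Q := P.bmGrowth x with hQ
  have hQ1 : 1 ≤ Q := one_le_bmGrowth hU0 hV0 hx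
  have hQ0 : 0 ≤ Q := zero_le_one.trans hQ1
  have hQη : 0 ≤ Q ^ η := Real.rpow_nonneg hQ0 η
  -- the approximants
  set y : ℕ → ℝ → ChainConfig := fun n s => severedFlow hB1 (Finset.Icc ((0 : ℤ) - n) ((0 : ℤ) + n)) s x
    with hy
  -- uniform bounds on `[-T, T]`, all `n`
  have hbound : ∀ (T : ℝ) (j : ℤ), ∃ B : ℝ, ∀ (n : ℕ) (s : ℝ), |s| ≤ |T| → ‖y n s j‖ ≤ B := by
    intro T j
    set k : ℕ := (j - 0).natAbs with hk
    have hj : j ∈ Finset.Icc ((0 : ℤ) - k) ((0 : ℤ) + k) := mem_cbox_natAbs 0 j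
    set L₀ := Real.log (Real.exp 1 + |((0 : ℤ) : ℝ)|) with hL₀
    have hL₀1 : L₀ = 1 := log_exp_add_abs_zero
    set X := (1 + |T| ^ 2 * (1 + |T| ^ (1 : ℝ)) * Q ^ γ₀) ^ (1 / (2 - γ₀)) with hX
    set n₀ : ℕ := ⌈2 * (k : ℝ) + 2 + A * X * L₀⌉₊ with hn₀
    have hn₀ge : 2 * (k : ℝ) + 2 + A * X * L₀ ≤ n₀ := Nat.le_ceil _
    set W := P.bmLocalEnergy 0 (n₀ + 1) x with hW
    have hW1 : 1 ≤ W := one_le_bmLocalEnergy hU0 hV0 0 _ x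
    set E : ℝ := 2 + 2 * (|T| * K * Q ^ η * (2 * k + 2 * L₀ + 7)) with hE
    have hE0 : 0 ≤ E := by rw [hE, hL₀1]; positivity
    -- energy bound for indices `n ≤ n₀`
    have hsmall : ∀ n : ℕ, n ≤ n₀ → ∀ s : ℝ, |s| ≤ |T| →
        ‖y n s j‖ ≤ ‖x j‖ + (|T| + 1) * Real.sqrt (2 * W) := by
      intro n hn s hs
      have hsq0 : 0 ≤ Real.sqrt (2 * W) := Real.sqrt_nonneg _
      by_cases hjn : j ∈ Finset.Icc ((0 : ℤ) - n) ((0 : ℤ) + n)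
      · have hWn : P.bmLocalEnergy 0 (n + 1) x ≤ W := bmLocalEnergy_mono hU0 hV0 0 (by omega) x
        have hf := severedFlow_energy_format hU hV hU0 hV0 hVe hB1 0 n x hWn s
        have hq := hf.2.2.1 j (cbox_subset (Nat.le_succ n) hjn)
        have hp := hf.2.2.2 j hjn
        rw [Prod.norm_def, Real.norm_eq_abs, Real.norm_eq_abs]
        have hx1 : |(x j).1| ≤ ‖x j‖ := by rw [Prod.norm_def]; exact le_max_left _ _
        have hnx : 0 ≤ ‖x j‖ := norm_nonneg _
        refine max_le ?_ ?_
        · calc |(y n s j).1| = |((y n s j).1 - (x j).1) + (x j).1| := by ring_nf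
            _ ≤ |(y n s j).1 - (x j).1| + |(x j).1| := abs_add_le _ _
            _ ≤ |s| * Real.sqrt (2 * W) + ‖x j‖ := add_le_add hq hx1
            _ ≤ |T| * Real.sqrt (2 * W) + ‖x j‖ := by gcongr
            _ ≤ ‖x j‖ + (|T| + 1) * Real.sqrt (2 * W) := by nlinarith
        · calc |(y n s j).2| ≤ Real.sqrt (2 * W) := hp
            _ ≤ ‖x j‖ + (|T| + 1) * Real.sqrt (2 * W) := by nlinarith [abs_nonneg T]
      · have : y n s j = x j := severedFlow_apply_of_not_mem hB1 _ s x hjn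
        rw [this]
        nlinarith [abs_nonneg T, norm_nonneg (x j)]
    refine ⟨‖x j‖ + (|T| + 1) * Real.sqrt (2 * W) + 2 * E, fun n s hs => ?_⟩
    by_cases hn : n ≤ n₀
    · linarith [hsmall n hn s hs]
    · -- beyond `n₀`: compare with the limit, and the limit with stage `n₀`
      have hn' : n₀ ≤ n := by omega
      have hrn : ∀ m : ℕ, n₀ ≤ m → ‖Φ s x j - y m s j‖ ≤ E := by
        intro m hm
        have hmr : 2 * (k : ℝ) + 2 + A * X * L₀ ≤ (m : ℝ) := by
          have : (n₀ : ℝ) ≤ m := by exact_mod_cast hm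
          linarith
        obtain ⟨h1, h2⟩ := hrate x hx 0 |T| (abs_nonneg T) k m hmr j hj s hs
        have hpos : 0 ≤ |T| * K * Q ^ η * (2 * k + 2 * L₀ + 7) := by rw [hL₀1]; positivity
        rw [Prod.norm_def, Real.norm_eq_abs, Real.norm_eq_abs]
        refine max_le (h1.trans ?_) (h2.trans ?_)
        · have : ((1 : ℝ) / 64) ^ (m + 1 - k) ≤ 1 := pow_le_one₀ (by norm_num) (by norm_num)
          rw [hE]; linarith
        · have h32 : ((1 : ℝ) / 32) ^ (m - k) ≤ 1 := pow_le_one₀ (by norm_num) (by norm_num)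
          change 2 * (|T| * K * Q ^ η * (2 * k + 2 * L₀ + 7) * (1 / 32) ^ (m - k)) ≤ E
          rw [hE]
          nlinarith
      calc ‖y n s j‖ = ‖(y n s j - Φ s x j) + (Φ s x j - y n₀ s j) + y n₀ s j‖ := by
            congr 1; abel
        _ ≤ ‖y n s j - Φ s x j‖ + ‖Φ s x j - y n₀ s j‖ + ‖y n₀ s j‖ := norm_add₃_le
        _ ≤ E + E + (‖x j‖ + (|T| + 1) * Real.sqrt (2 * W)) := by
            refine add_le_add (add_le_add ?_ (hrn n₀ le_rfl)) (hsmall n₀ le_rfl s hs)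
            rw [norm_sub_rev]; exact hrn n hn'
        _ = ‖x j‖ + (|T| + 1) * Real.sqrt (2 * W) + 2 * E := by ring
  -- the bounding function `ρ`
  choose B hB using hbound
  set ρ : ℝ → ℤ → ℝ := fun T j => sSup {r : ℝ | ∃ (n : ℕ) (s : ℝ), |s| ≤ |T| ∧ r = ‖y n s j‖} with hρ
  have hbdd : ∀ T j, BddAbove {r : ℝ | ∃ (n : ℕ) (s : ℝ), |s| ≤ |T| ∧ r = ‖y n s j‖} := fun T j =>
    ⟨B T j, by rintro r ⟨n, s, hs, rfl⟩; exact hB T j n s hs⟩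
  have hne : ∀ T j, ({r : ℝ | ∃ (n : ℕ) (s : ℝ), |s| ≤ |T| ∧ r = ‖y n s j‖}).Nonempty := fun T j =>
    ⟨‖y 0 0 j‖, 0, 0, by simp, rfl⟩
  have hρ1 : ∀ n T j, ‖y n T j‖ ≤ ρ T j := fun n T j =>
    le_csSup (hbdd T j) ⟨n, T, le_rfl, rfl⟩
  have hρm : ∀ (j : ℤ) (s T : ℝ), |s| ≤ |T| → ρ s j ≤ ρ T j := fun j s T hsT =>
    csSup_le_csSup (hbdd T j) (hne s j) (by
      rintro r ⟨n, s', hs', rfl⟩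
      exact ⟨n, s', hs'.trans hsT, rfl⟩)
  -- eventually the `j`-th equations hold
  have hsol : ∀ (T : ℝ) (j : ℤ), ∀ᶠ n : ℕ in atTop, ∀ t ∈ Icc (-T) T,
      HasDerivAt (fun s => (y n s j).1) (y n t j).2 t ∧
        HasDerivAt (fun s => (y n s j).2) (P.force (y n t) j) t := by
    intro T j
    refine eventually_atTop.2 ⟨(j - 0).natAbs, fun n hn t _ => ?_⟩
    have hjn : j ∈ Finset.Icc ((0 : ℤ) - n) ((0 : ℤ) + n) := by
      rw [Finset.mem_Icc]; omega
    exact (isSeveredSolution_severedFlow hB1 _ x).1 j hjn t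
  exact isSolution_of_tendsto hUc hVc (fun s j => hΦ x hx s j) hρ1 hρm hsol

end Limit

/-! ### §8 Uniqueness among solutions with locally bounded `Q` (the iteration once more) -/

section UniqueLB

variable {P : OscillatorChain} {s₁ s₂ : ℕ}

/-- A constant dominated by a null sequence from some index on is `≤ 0`. [folklore] -/
theorem le_zero_of_le_tendsto_zero {c : ℝ} {b : ℕ → ℝ} (hb : Tendsto b atTop (𝓝 0)) {n₀ : ℕ}
    (h : ∀ n, n₀ ≤ n → c ≤ b n) : c ≤ 0 :=
  ge_of_tendsto hb (eventually_atTop.2 ⟨n₀, h⟩)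

/-- **Uniqueness in the class of solutions with locally bounded growth functional** (the
Dobrushin–Fritz argument that BM use for the independence of `μ`; LLL 1977 Thm 2): two global
solutions of (2.1) with the same initial datum, both staying in `𝒳₀` with `Q ≤ N` on `|s| ≤ t`,
coincide on `|s| ≤ t` (the iteration around each site `i`, to depth `n → ∞`).
[cite: ButtaMarchioro2016, §3 (independence of μ); LanfordLebowitzLieb1977, §3 Thm 2] -/
theorem eq_of_isSolution_of_bmGrowth_le (hs₁ : 1 ≤ s₁) (hs₂ : 1 ≤ s₂)
    (hU1 : IsEvenPolyOfDegree P.U s₁) (hV1 : IsEvenPolyOfDegree P.V s₂)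
    {γ₁ γ₂ : ℝ → ChainConfig} (hγ₁ : P.IsSolution γ₁) (hγ₂ : P.IsSolution γ₂) (h0 : γ₁ 0 = γ₂ 0)
    {t N : ℝ} (hb₁ : ∀ s, |s| ≤ t → γ₁ s ∈ P.bmGood ∧ P.bmGrowth (γ₁ s) ≤ N)
    (hb₂ : ∀ s, |s| ≤ t → γ₂ s ∈ P.bmGood ∧ P.bmGrowth (γ₂ s) ≤ N) :
    ∀ s, |s| ≤ t → γ₁ s = γ₂ s := by
  intro s hs
  by_cases hs0 : s = 0
  · subst hs0; exact h0
  have ht : 0 ≤ t := (abs_nonneg s).trans hs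
  have hU0 : ∀ r, 0 ≤ P.U r := hU1.choose_spec.2.2
  have hV0 : ∀ r, 0 ≤ P.V r := hV1.choose_spec.2.2
  obtain ⟨K₁, K₂, hK₁0, hK₂1, hLipF, -, -, -, -⟩ := exists_constants hs₁ hs₂ hU1 hV1
  set η : ℝ := (((max s₁ s₂ : ℕ) : ℝ) - 1) / ((max s₁ s₂ : ℕ) : ℝ) with hη
  have hS1 : (1 : ℝ) ≤ ((max s₁ s₂ : ℕ) : ℝ) := by exact_mod_cast le_max_of_le_left hs₁
  have hS0 : (0 : ℝ) < ((max s₁ s₂ : ℕ) : ℝ) := by linarith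
  have hη1 : η ≤ 1 := by rw [hη, div_le_one hS0]; linarith
  have hη0 : 0 ≤ η := by rw [hη]; exact div_nonneg (by linarith) hS0.le
  set γ₀ : ℝ := (η + 2) / 2 with hγ₀
  have hγ : η < γ₀ := by rw [hγ₀]; linarith
  have hγ2 : γ₀ < 2 := by rw [hγ₀]; linarith
  obtain ⟨A, hA1, hA⟩ := bm_arith hK₁0 hη0 hγ hγ2 one_pos
  set N' : ℝ := max N 1 with hN'
  have hN'1 : 1 ≤ N' := le_max_right _ _
  have hN'0 : 0 ≤ N' := zero_le_one.trans hN'1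
  have hNN' : N ≤ N' := le_max_left _ _
  -- the bound at site `i`, depth `n + 1`
  funext i
  set L := Real.log (Real.exp 1 + |(i : ℝ)|) with hL
  have hL1 : 1 ≤ L := one_le_log_exp_add_abs i
  set X := (1 + t ^ 2 * (1 + t ^ (1 : ℝ)) * N' ^ γ₀) ^ (1 / (2 - γ₀)) with hX
  set n₀ : ℕ := ⌈A * X * L⌉₊ with hn₀
  have hmain : ∀ n : ℕ, n₀ ≤ n →
      |(γ₁ s i).1 - (γ₂ s i).1| ≤ (1 / 64) ^ (n + 1) ∧
        |(γ₁ s i).2 - (γ₂ s i).2| ≤ (1 / 64) ^ (n + 1) * (2 * (n + 1 : ℕ)) / |s| := by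
    intro n hn
    set Y : ℝ := N' * (2 * n + 2 * L + 5) with hY
    have hY1 : 1 ≤ Y := by
      rw [hY]; have : (0 : ℝ) ≤ n := Nat.cast_nonneg n; nlinarith
    have hY0 : 0 ≤ Y := zero_le_one.trans hY1
    -- local energies of both solutions on `Λ_{i,n+1}` are `≤ Y`
    have hW : ∀ (γ : ℝ → ChainConfig), (∀ r, |r| ≤ t → γ r ∈ P.bmGood ∧ P.bmGrowth (γ r) ≤ N) →
        ∀ r, |r| ≤ t → P.bmLocalEnergy i (n + 1) (γ r) ≤ Y := by
      intro γ hb r hr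
      obtain ⟨hg, hQ⟩ := hb r hr
      have h := bmLocalEnergy_le hU0 hV0 hg i (n + 1)
      have hQ0 : 0 ≤ P.bmGrowth (γ r) := zero_le_one.trans (one_le_bmGrowth hU0 hV0 hg)
      push_cast at h
      calc P.bmLocalEnergy i (n + 1) (γ r) ≤ P.bmGrowth (γ r) * (2 * (n + 1) + 2 * L + 3) := h
        _ ≤ N' * (2 * (n + 1) + 2 * L + 3) := by
            apply mul_le_mul_of_nonneg_right (hQ.trans hNN')
            have : (0 : ℝ) ≤ n := Nat.cast_nonneg n
            linarith
        _ = Y := by rw [hY]; ring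
    -- the format hypotheses for a solution with `W_{i,n+1} ≤ Y`
    have hfmt : ∀ (γ : ℝ → ChainConfig), P.IsSolution γ →
        (∀ r, |r| ≤ t → P.bmLocalEnergy i (n + 1) (γ r) ≤ Y) →
        (∀ r, |r| ≤ t → ∀ j ∈ Finset.Icc (i - (n + 1 : ℕ)) (i + (n + 1 : ℕ)), P.U (γ r j).1 ≤ Y) ∧
        (∀ r, |r| ≤ t → ∀ j ∈ Finset.Icc (i - n - 1) (i + n),
          P.V ((γ r (j + 1)).1 - (γ r j).1) ≤ Y) ∧
        (∀ r, |r| ≤ t → ∀ j ∈ Finset.Icc (i - (n + 1 : ℕ)) (i + (n + 1 : ℕ)),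
          |(γ r j).1 - (γ 0 j).1| ≤ t * Real.sqrt (2 * Y)) := by
      intro γ hγ hWγ
      refine ⟨fun r hr j hj => ?_, fun r hr j hj => ?_, fun r hr j hj => ?_⟩
      · have h := site_le_bmLocalEnergy hU0 hV0 (γ r) hj
        nlinarith [hWγ r hr, sq_nonneg (γ r j).2]
      · have hj1 : j + 1 ∈ Finset.Icc (i - (n + 1 : ℕ)) (i + (n + 1 : ℕ)) := by
          rw [Finset.mem_Icc] at hj ⊢; push_cast; omega
        have hj2 : j + 1 - 1 ∈ Finset.Icc (i - (n + 1 : ℕ)) (i + (n + 1 : ℕ)) := by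
          rw [Finset.mem_Icc] at hj ⊢; push_cast; omega
        have h := bond_le_bmLocalEnergy hU0 hV0 (γ r) hj1 hj2
        simp only [add_sub_cancel_right] at h
        exact h.trans (hWγ r hr)
      · have hp : ∀ r', |r'| ≤ t → |(γ r' j).2| ≤ Real.sqrt (2 * Y) := by
          intro r' hr'
          have h := site_le_bmLocalEnergy hU0 hV0 (γ r') hj
          have h2 : (γ r' j).2 ^ 2 ≤ 2 * Y := by nlinarith [hWγ r' hr', hU0 (γ r' j).1]
          calc |(γ r' j).2| = Real.sqrt ((γ r' j).2 ^ 2) := (Real.sqrt_sq_eq_abs _).symm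
            _ ≤ Real.sqrt (2 * Y) := Real.sqrt_le_sqrt h2
        have hr' : r ∈ Icc (-t) t := abs_le.1 hr
        have h0t : (0 : ℝ) ∈ Icc (-t) t := ⟨by linarith, ht⟩
        have hmv := (convex_Icc (-t) t).norm_image_sub_le_of_norm_hasDerivWithin_le
          (f := fun r => (γ r j).1) (f' := fun r => (γ r j).2)
          (fun r _ => ((hγ j r).1).hasDerivWithinAt)
          (fun r hr => by rw [Real.norm_eq_abs]; exact hp r (abs_le.2 hr)) h0t hr'
        rw [Real.norm_eq_abs, Real.norm_eq_abs, sub_zero] at hmv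
        calc |(γ r j).1 - (γ 0 j).1| ≤ Real.sqrt (2 * Y) * |r| := hmv
          _ ≤ Real.sqrt (2 * Y) * t := mul_le_mul_of_nonneg_left hr (Real.sqrt_nonneg _)
          _ = t * Real.sqrt (2 * Y) := mul_comm _ _
    obtain ⟨hU₁, hV₁, hq₁⟩ := hfmt γ₁ hγ₁ (hW γ₁ hb₁)
    obtain ⟨hU₂, hV₂, hq₂⟩ := hfmt γ₂ hγ₂ (hW γ₂ hb₂)
    have key := df_iterate_energy (K₁ := K₁) (η := η) hLipF (x := γ₁ 0) (μ := i) (n := n) (t := t)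
      hY1 (γ₁ := γ₁) (γ₂ := γ₂) (fun j _ r => hγ₁ j r) (fun j _ r => hγ₂ j r)
      (fun j _ => rfl) (fun j _ => by rw [h0]) hU₁ hU₂ hV₁ hV₂ hq₁
      (fun r hr j hj => by rw [h0]; exact hq₂ r hr j hj)
      (n + 1) 0 (by omega) i (by rw [Finset.mem_Icc]; push_cast; omega) s hs
    obtain ⟨hq, hp⟩ := key
    have hp := hp (by omega)
    -- arithmetic
    have hd : A * (1 + t ^ 2 * (1 + t ^ (1 : ℝ)) * N' ^ γ₀) ^ (1 / (2 - γ₀)) * L ≤ ((n + 1 : ℕ) : ℝ) := by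
      have h1 : A * X * L ≤ n₀ := Nat.le_ceil _
      have h2 : (n₀ : ℝ) ≤ n := by exact_mod_cast hn
      push_cast; linarith
    have hYle : Y ≤ 18 * N' * ((n + 1 : ℕ) + L) := by
      rw [hY]; push_cast; nlinarith
    have harith := hA N' L t Y (n + 1) hN'1 hL1 ht hY1 hYle hd
    have hmono : 2 * Real.sqrt 2 * t * Real.sqrt Y * (K₁ * Y ^ η) ^ (n + 1) * |s| ^ (2 * (n + 1)) /
        (2 * (n + 1)).factorial ≤ (1 / 64) ^ (n + 1) := by
      refine le_trans ?_ harith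
      have hf : (0 : ℝ) < (2 * (n + 1)).factorial := by positivity
      apply div_le_div_of_nonneg_right _ hf.le
      have : |s| ^ (2 * (n + 1)) ≤ t ^ (2 * (n + 1)) := pow_le_pow_left₀ (abs_nonneg s) hs _
      have hYη : 0 ≤ Y ^ η := Real.rpow_nonneg hY0 η
      exact mul_le_mul_of_nonneg_left this (by positivity)
    exact ⟨hq.trans hmono, hp.trans (iter_p_bound_of_q_bound (by omega) hs0 hmono)⟩
  -- let `n → ∞`
  have hs' : 0 < |s| := abs_pos.2 hs0
  have hlim := tendsto_geom_aux (1 + 2 / |s|) 0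
  simp only [Nat.sub_zero] at hlim
  have hmaj : ∀ n : ℕ, n₀ ≤ n →
      max |(γ₁ s i).1 - (γ₂ s i).1| |(γ₁ s i).2 - (γ₂ s i).2| ≤
        (1 + 2 / |s|) * ((1 / 64) ^ n + (n : ℝ) * (1 / 64) ^ n) := by
    intro n hn
    obtain ⟨hq, hp⟩ := hmain n hn
    set S : ℝ := (1 / 64) ^ n + (n : ℝ) * (1 / 64) ^ n with hS
    have hSnn : 0 ≤ S := by rw [hS]; positivity
    have h64 : ((1 : ℝ) / 64) ^ (n + 1) ≤ (1 / 64) ^ n :=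
      pow_le_pow_of_le_one (by norm_num) (by norm_num) (Nat.le_succ n)
    have h2s : 0 ≤ 2 / |s| := by positivity
    refine max_le ?_ ?_
    · calc |(γ₁ s i).1 - (γ₂ s i).1| ≤ (1 / 64) ^ (n + 1) := hq
        _ ≤ (1 / 64) ^ n := h64
        _ ≤ S := by rw [hS]; exact le_add_of_nonneg_right (by positivity)
        _ = 1 * S := (one_mul S).symm
        _ ≤ (1 + 2 / |s|) * S := mul_le_mul_of_nonneg_right (by linarith) hSnn
    · calc |(γ₁ s i).2 - (γ₂ s i).2| ≤ (1 / 64) ^ (n + 1) * (2 * (n + 1 : ℕ)) / |s| := hp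
        _ ≤ (1 / 64) ^ n * (2 * ((n : ℝ) + 1)) / |s| := by
            refine div_le_div_of_nonneg_right ?_ (abs_nonneg s)
            push_cast
            exact mul_le_mul_of_nonneg_right h64 (by positivity)
        _ = (2 / |s|) * S := by rw [hS]; field_simp; ring
        _ ≤ (1 + 2 / |s|) * S := mul_le_mul_of_nonneg_right (by linarith) hSnn
  have hle := le_zero_of_le_tendsto_zero hlim hmaj
  have h1 : |(γ₁ s i).1 - (γ₂ s i).1| ≤ 0 := (le_max_left _ _).trans hle
  have h2 : |(γ₁ s i).2 - (γ₂ s i).2| ≤ 0 := (le_max_right _ _).trans hle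
  have e1 : (γ₁ s i).1 = (γ₂ s i).1 := by
    have := abs_nonpos_iff.1 h1; linarith
  have e2 : (γ₁ s i).2 = (γ₂ s i).2 := by
    have := abs_nonpos_iff.1 h2; linarith
  exact Prod.ext e1 e2

end UniqueLB

/-! ### §9 The growth estimate (2.7) -/

section Growth

variable {P : OscillatorChain} {s₁ s₂ : ℕ}

/-- **Comparison of local energies of two nearby configurations**: if every site term of `σ` exceeds
that of `σ'` by at most `δ₁` and every pair term by at most `δ₂ ≥ 0` (on `Λ_{μ,k}`), then
`W_{μ,k}(σ) ≤ W_{μ,k}(σ') + (2k+1)(δ₁ + 2δ₂)`. [folklore] -/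
theorem bmLocalEnergy_le_add (μ : ℤ) (k : ℕ) (σ σ' : ChainConfig) {δ₁ δ₂ : ℝ} (hδ₂ : 0 ≤ δ₂)
    (hsite : ∀ j ∈ Finset.Icc (μ - k) (μ + k),
      (σ j).2 ^ 2 / 2 + P.U (σ j).1 ≤ (σ' j).2 ^ 2 / 2 + P.U (σ' j).1 + δ₁)
    (hpair : ∀ j ∈ Finset.Icc (μ - k) (μ + k), ∀ j' ∈ Finset.Icc (μ - k) (μ + k), |j' - j| = 1 →
      P.V ((σ j).1 - (σ j').1) ≤ P.V ((σ' j).1 - (σ' j').1) + δ₂) :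
    P.bmLocalEnergy μ k σ ≤ P.bmLocalEnergy μ k σ' + (2 * k + 1) * (δ₁ + 2 * δ₂) := by
  unfold bmLocalEnergy
  set B := Finset.Icc (μ - k) (μ + k) with hB
  have hcard : (B.card : ℝ) = 2 * k + 1 := by rw [hB, card_cbox]; push_cast; ring
  have h1 : ∑ j ∈ B, ((σ j).2 ^ 2 / 2 + P.U (σ j).1 + 1) ≤
      ∑ j ∈ B, ((σ' j).2 ^ 2 / 2 + P.U (σ' j).1 + 1) + (2 * k + 1) * δ₁ := by
    calc ∑ j ∈ B, ((σ j).2 ^ 2 / 2 + P.U (σ j).1 + 1)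
        ≤ ∑ j ∈ B, (((σ' j).2 ^ 2 / 2 + P.U (σ' j).1 + 1) + δ₁) :=
          Finset.sum_le_sum fun j hj => by linarith [hsite j hj]
      _ = ∑ j ∈ B, ((σ' j).2 ^ 2 / 2 + P.U (σ' j).1 + 1) + (2 * k + 1) * δ₁ := by
          rw [Finset.sum_add_distrib, Finset.sum_const, nsmul_eq_mul, hcard]
  have hinner : ∀ j ∈ B, ∑ j' ∈ B, (if |j' - j| = 1 then P.V ((σ j).1 - (σ j').1) else 0) ≤
      ∑ j' ∈ B, (if |j' - j| = 1 then P.V ((σ' j).1 - (σ' j').1) else 0) + 2 * δ₂ := by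
    intro j hj
    have hle : ∀ j' ∈ B, (if |j' - j| = 1 then P.V ((σ j).1 - (σ j').1) else 0) ≤
        (if |j' - j| = 1 then P.V ((σ' j).1 - (σ' j').1) else 0) + (if |j' - j| = 1 then δ₂ else 0) := by
      intro j' hj'
      split_ifs with h
      · exact hpair j hj j' hj' h
      · simp
    have hδsum : ∑ j' ∈ B, (if |j' - j| = 1 then δ₂ else 0) ≤ 2 * δ₂ := by
      rw [← Finset.sum_filter]
      have hsub : B.filter (fun j' => |j' - j| = 1) ⊆ ({j - 1, j + 1} : Finset ℤ) := by
        intro j' hj'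
        rw [Finset.mem_filter] at hj'
        rw [Finset.mem_insert, Finset.mem_singleton]
        rcases abs_eq (zero_le_one' ℤ) |>.1 hj'.2 with h | h <;> omega
      have hne : j - 1 ≠ j + 1 := by omega
      calc ∑ j' ∈ B.filter (fun j' => |j' - j| = 1), δ₂ ≤ ∑ j' ∈ ({j - 1, j + 1} : Finset ℤ), δ₂ :=
            Finset.sum_le_sum_of_subset_of_nonneg hsub fun _ _ _ => hδ₂
        _ = 2 * δ₂ := by rw [Finset.sum_pair hne]; ring
    calc ∑ j' ∈ B, (if |j' - j| = 1 then P.V ((σ j).1 - (σ j').1) else 0)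
        ≤ ∑ j' ∈ B, ((if |j' - j| = 1 then P.V ((σ' j).1 - (σ' j').1) else 0) +
            (if |j' - j| = 1 then δ₂ else 0)) := Finset.sum_le_sum hle
      _ ≤ ∑ j' ∈ B, (if |j' - j| = 1 then P.V ((σ' j).1 - (σ' j').1) else 0) + 2 * δ₂ := by
          rw [Finset.sum_add_distrib]; linarith
  have h2 : ∑ j ∈ B, ∑ j' ∈ B, (if |j' - j| = 1 then P.V ((σ j).1 - (σ j').1) else 0) ≤
      ∑ j ∈ B, ∑ j' ∈ B, (if |j' - j| = 1 then P.V ((σ' j).1 - (σ' j').1) else 0) +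
        (2 * k + 1) * (2 * δ₂) := by
    calc ∑ j ∈ B, ∑ j' ∈ B, (if |j' - j| = 1 then P.V ((σ j).1 - (σ j').1) else 0)
        ≤ ∑ j ∈ B, (∑ j' ∈ B, (if |j' - j| = 1 then P.V ((σ' j).1 - (σ' j').1) else 0) + 2 * δ₂) :=
          Finset.sum_le_sum hinner
      _ = ∑ j ∈ B, ∑ j' ∈ B, (if |j' - j| = 1 then P.V ((σ' j).1 - (σ' j').1) else 0) +
          (2 * k + 1) * (2 * δ₂) := by
          rw [Finset.sum_add_distrib, Finset.sum_const, nsmul_eq_mul, hcard]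
  linarith

/-- `(1 + u)^p ≤ 2^p (1 + u^p)` for `u ≥ 0`, `p ≥ 0`. [folklore] -/
theorem one_add_rpow_le {u p : ℝ} (hu : 0 ≤ u) (hp : 0 ≤ p) : (1 + u) ^ p ≤ 2 ^ p * (1 + u ^ p) := by
  have h := add_rpow_le_two_rpow_mul zero_le_one hu hp
  rwa [Real.one_rpow] at h

/-- `m^a ≤ (2^a)^m` (from `m < 2^m`), in `ℝ`. [folklore] -/
theorem pow_le_two_pow_pow (m a : ℕ) : (m : ℝ) ^ a ≤ ((2 : ℝ) ^ a) ^ m := by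
  have h : (m : ℝ) ≤ 2 ^ m := by exact_mod_cast (Nat.lt_two_pow_self).le
  calc (m : ℝ) ^ a ≤ ((2 : ℝ) ^ m) ^ a := pow_le_pow_left₀ (Nat.cast_nonneg m) h a
    _ = ((2 : ℝ) ^ a) ^ m := by rw [← pow_mul, ← pow_mul, mul_comm]

/-- `m^a r^m ≤ 1` when `0 ≤ r` and `2^a r ≤ 1`. [folklore] -/
theorem pow_mul_pow_le_one {m a : ℕ} {r : ℝ} (hr : 0 ≤ r) (h : 2 ^ a * r ≤ 1) : (m : ℝ) ^ a * r ^ m ≤ 1 := by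
  calc (m : ℝ) ^ a * r ^ m ≤ ((2 : ℝ) ^ a) ^ m * r ^ m :=
        mul_le_mul_of_nonneg_right (pow_le_two_pow_pow m a) (pow_nonneg hr m)
    _ = ((2 : ℝ) ^ a * r) ^ m := by rw [mul_pow]
    _ ≤ 1 := pow_le_one₀ (by positivity) h

/-- The key exponent inequality of the momentum terms: for `Q ≥ 1`, `0 ≤ γ ≤ 2`, `2η - 1 ≤ γ`,
`t ≥ 0` and `X ≥ 1` with `X^{2-γ} ≥ 1 + t² Q^γ`, one has `t Q^{η - 1/2} ≤ X`. [cite: ButtaMarchioro2016, §3 (proof of (2.7))] -/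
theorem t_mul_rpow_le {t Q η γ X : ℝ} (ht : 0 ≤ t) (hQ : 1 ≤ Q) (hηγ : 2 * η - 1 ≤ γ) (hγ0 : 0 ≤ γ)
    (hX1 : 1 ≤ X) (hX : 1 + t ^ 2 * Q ^ γ ≤ X ^ (2 - γ)) :
    t * Q ^ (η - 1 / 2) ≤ X := by
  have hQ0 : 0 < Q := one_pos.trans_le hQ
  have hX0 : 0 ≤ X := zero_le_one.trans hX1
  have h1 : Q ^ (2 * η - 1) ≤ Q ^ γ := Real.rpow_le_rpow_of_exponent_le hQ hηγ
  have h2 : (t * Q ^ (η - 1 / 2)) ^ 2 ≤ X ^ 2 := by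
    calc (t * Q ^ (η - 1 / 2)) ^ 2 = t ^ 2 * Q ^ (2 * η - 1) := by
          rw [mul_pow, ← Real.rpow_natCast (Q ^ (η - 1 / 2)) 2, ← Real.rpow_mul hQ0.le]
          congr 1; congr 1; push_cast; ring
      _ ≤ t ^ 2 * Q ^ γ := mul_le_mul_of_nonneg_left h1 (sq_nonneg t)
      _ ≤ X ^ (2 - γ) := by linarith
      _ ≤ X ^ (2 : ℝ) := Real.rpow_le_rpow_of_exponent_le hX1 (by linarith)
      _ = X ^ 2 := Real.rpow_two X
  have h3 : 0 ≤ t * Q ^ (η - 1 / 2) := mul_nonneg ht (Real.rpow_nonneg hQ0.le _)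
  nlinarith

/-- **The error terms of the growth estimate are `O(Q)`** (BM §3, last display of the proof of
Thm 2.1, with the honest prefactors): with `m = n_k^* - k`, the momentum, pinning and pair corrections
coming from the convergence rate are bounded by `(64K + 256K² + 30K₂) Q`. Pure real arithmetic.
[cite: ButtaMarchioro2016, §3 (end of the proof of Thm 2.1)] -/
theorem growth_err_le {t K K₂ Q η γ X Y εq εp : ℝ} {m : ℕ} (ht : 0 ≤ t) (hK : 0 ≤ K) (hK₂ : 0 ≤ K₂)
    (hQ : 1 ≤ Q) (hηγ : 2 * η - 1 ≤ γ) (hγ0 : 0 ≤ γ) (hX1 : 1 ≤ X)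
    (hX : 1 + t ^ 2 * Q ^ γ ≤ X ^ (2 - γ)) (hXm : X ≤ m) (hm2 : 2 ≤ (m : ℝ))
    (hYm : Y ≤ 6 * Q * m) (hεq0 : 0 ≤ εq) (hεq : εq ≤ (1 / 64) ^ m) (hεp0 : 0 ≤ εp)
    (hεp : εp ≤ 16 * t * K * Q ^ η * m * (1 / 32) ^ m) :
    εp * (Real.sqrt (2 * Y) + εp) + K₂ * Y * εq + 2 * (2 * K₂ * Y * εq) ≤
      (64 * K + 256 * K ^ 2 + 30 * K₂) * Q := by
  have hQ0 : 0 < Q := one_pos.trans_le hQ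
  have hm0 : (0 : ℝ) < m := by linarith
  have hQη : 0 ≤ Q ^ η := Real.rpow_nonneg hQ0.le η
  have htQ : t * Q ^ (η - 1 / 2) ≤ m := (t_mul_rpow_le ht hQ hηγ hγ0 hX1 hX).trans hXm
  have htQ0 : 0 ≤ t * Q ^ (η - 1 / 2) := mul_nonneg ht (Real.rpow_nonneg hQ0.le _)
  have hQsplit1 : Q ^ η * Real.sqrt Q = Q ^ (η - 1 / 2) * Q := by
    rw [Real.sqrt_eq_rpow, ← Real.rpow_add hQ0]
    conv_rhs => rw [← Real.rpow_one Q, ← Real.rpow_mul hQ0.le, ← Real.rpow_add hQ0]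
    congr 1; ring
  have hQsplit2 : (Q ^ η) ^ 2 = (Q ^ (η - 1 / 2)) ^ 2 * Q := by
    rw [← Real.rpow_natCast (Q ^ η) 2, ← Real.rpow_mul hQ0.le,
      ← Real.rpow_natCast (Q ^ (η - 1 / 2)) 2, ← Real.rpow_mul hQ0.le]
    conv_rhs => rw [← Real.rpow_one Q, ← Real.rpow_mul hQ0.le, ← Real.rpow_add hQ0]
    congr 1; push_cast; ring
  have hsqrtY : Real.sqrt (2 * Y) ≤ 4 * Real.sqrt Q * Real.sqrt m := by
    have h12 : Real.sqrt 12 ≤ 4 := by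
      rw [show (4 : ℝ) = Real.sqrt 16 by
        rw [show (16 : ℝ) = 4 ^ 2 by norm_num, Real.sqrt_sq (by norm_num)]]
      exact Real.sqrt_le_sqrt (by norm_num)
    calc Real.sqrt (2 * Y) ≤ Real.sqrt (12 * Q * m) := Real.sqrt_le_sqrt (by linarith)
      _ = Real.sqrt 12 * Real.sqrt Q * Real.sqrt m := by
          rw [Real.sqrt_mul (mul_nonneg (by norm_num) hQ0.le), Real.sqrt_mul (by norm_num : (0 : ℝ) ≤ 12)]
      _ ≤ 4 * Real.sqrt Q * Real.sqrt m := by gcongr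
  have hsm : Real.sqrt (m : ℝ) ≤ m := by
    rw [Real.sqrt_le_left (by linarith)]; nlinarith
  -- term 1
  have hT1 : εp * Real.sqrt (2 * Y) ≤ 64 * K * Q := by
    have h32 : (m : ℝ) ^ 3 * ((1 : ℝ) / 32) ^ m ≤ 1 := pow_mul_pow_le_one (by norm_num) (by norm_num)
    calc εp * Real.sqrt (2 * Y)
        ≤ (16 * t * K * Q ^ η * m * (1 / 32) ^ m) * (4 * Real.sqrt Q * Real.sqrt m) :=
          mul_le_mul hεp hsqrtY (Real.sqrt_nonneg _) (by positivity)
      _ = 64 * K * (t * Q ^ (η - 1 / 2)) * Q * (m * Real.sqrt m * (1 / 32) ^ m) := by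
          calc (16 * t * K * Q ^ η * m * (1 / 32) ^ m) * (4 * Real.sqrt Q * Real.sqrt m)
              = 64 * K * t * (Q ^ η * Real.sqrt Q) * (m * Real.sqrt m * (1 / 32) ^ m) := by ring
            _ = 64 * K * (t * Q ^ (η - 1 / 2)) * Q * (m * Real.sqrt m * (1 / 32) ^ m) := by
                rw [hQsplit1]; ring
      _ ≤ 64 * K * m * Q * (m * m * (1 / 32) ^ m) := by gcongr
      _ = 64 * K * Q * ((m : ℝ) ^ 3 * (1 / 32) ^ m) := by ring
      _ ≤ 64 * K * Q * 1 := by gcongr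
      _ = 64 * K * Q := mul_one _
  -- term 2
  have hT2 : εp * εp ≤ 256 * K ^ 2 * Q := by
    have h1024 : (m : ℝ) ^ 4 * ((1 : ℝ) / 1024) ^ m ≤ 1 := pow_mul_pow_le_one (by norm_num) (by norm_num)
    have hsq : εp * εp ≤ (16 * t * K * Q ^ η * m * (1 / 32) ^ m) ^ 2 := by
      rw [← sq]; exact pow_le_pow_left₀ hεp0 hεp 2
    calc εp * εp ≤ (16 * t * K * Q ^ η * m * (1 / 32) ^ m) ^ 2 := hsq
      _ = 256 * K ^ 2 * ((t * Q ^ (η - 1 / 2)) ^ 2 * Q) * ((m : ℝ) ^ 2 * ((1 / 32) ^ m) ^ 2) := by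
          calc (16 * t * K * Q ^ η * m * (1 / 32) ^ m) ^ 2
              = 256 * K ^ 2 * (t ^ 2 * (Q ^ η) ^ 2) * ((m : ℝ) ^ 2 * ((1 / 32) ^ m) ^ 2) := by ring
            _ = 256 * K ^ 2 * ((t * Q ^ (η - 1 / 2)) ^ 2 * Q) * ((m : ℝ) ^ 2 * ((1 / 32) ^ m) ^ 2) := by
                rw [hQsplit2]; ring
      _ ≤ 256 * K ^ 2 * ((m : ℝ) ^ 2 * Q) * ((m : ℝ) ^ 2 * ((1 / 32) ^ m) ^ 2) := by
          have : (t * Q ^ (η - 1 / 2)) ^ 2 ≤ (m : ℝ) ^ 2 := pow_le_pow_left₀ htQ0 htQ 2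
          gcongr
      _ = 256 * K ^ 2 * Q * ((m : ℝ) ^ 4 * (1 / 1024) ^ m) := by
          rw [← pow_mul, show ((1 : ℝ) / 32) ^ (m * 2) = (1 / 1024) ^ m by
            rw [mul_comm, pow_mul]; norm_num]
          ring
      _ ≤ 256 * K ^ 2 * Q * 1 := by gcongr
      _ = 256 * K ^ 2 * Q := mul_one _
  -- term 3
  have hT3 : 5 * K₂ * Y * εq ≤ 30 * K₂ * Q := by
    have h64 : (m : ℝ) ^ 1 * ((1 : ℝ) / 64) ^ m ≤ 1 := pow_mul_pow_le_one (by norm_num) (by norm_num)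
    rw [pow_one] at h64
    calc 5 * K₂ * Y * εq ≤ 5 * K₂ * (6 * Q * m) * (1 / 64) ^ m := by gcongr
      _ = 30 * K₂ * Q * (m * (1 / 64) ^ m) := by ring
      _ ≤ 30 * K₂ * Q * 1 := by gcongr
      _ = 30 * K₂ * Q := mul_one _
  nlinarith

/-- **`X ≤ 4^{1/(2-γ)} G`**: the scale `X = (1 + t²(1+t^{β'}) Q^γ)^{1/(2-γ)}` of `n_k^*` is bounded
by `4^{1/(2-γ)} [1 + t^{2/(2-γ)} (1 + t^β) Q^{γ/(2-γ)}]` when `β' = (2-γ)β` (BM: "as `β' := (2-γ)β/d`,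
the ratio … is bounded from above by the right-hand side of (2.7)"). [cite: ButtaMarchioro2016, §3 (end of the proof of Thm 2.1)] -/
theorem scale_le_four_rpow_mul {t Q γ β : ℝ} (ht : 0 ≤ t) (hQ : 0 < Q) (hγ2 : γ < 2) (hβ : 0 < β) :
    (1 + t ^ 2 * (1 + t ^ ((2 - γ) * β)) * Q ^ γ) ^ (1 / (2 - γ)) ≤
      4 ^ (1 / (2 - γ)) * (1 + t ^ (2 / (2 - γ)) * (1 + t ^ β) * Q ^ (γ / (2 - γ))) := by
  have h2γ : 0 < 2 - γ := by linarith
  set p : ℝ := 1 / (2 - γ) with hp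
  have hp0 : 0 < p := by rw [hp]; positivity
  have htb : 0 ≤ t ^ ((2 - γ) * β) := Real.rpow_nonneg ht _
  have hQγ : 0 ≤ Q ^ γ := Real.rpow_nonneg hQ.le γ
  have hτ0 : 0 ≤ t ^ 2 * (1 + t ^ ((2 - γ) * β)) := by positivity
  have h1 : (1 + t ^ 2 * (1 + t ^ ((2 - γ) * β)) * Q ^ γ) ^ p ≤
      2 ^ p * (1 + (t ^ 2 * (1 + t ^ ((2 - γ) * β)) * Q ^ γ) ^ p) :=
    one_add_rpow_le (by positivity) hp0.le
  have h2 : (t ^ 2 * (1 + t ^ ((2 - γ) * β)) * Q ^ γ) ^ p =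
      t ^ (2 / (2 - γ)) * (1 + t ^ ((2 - γ) * β)) ^ p * Q ^ (γ / (2 - γ)) := by
    rw [Real.mul_rpow hτ0 hQγ, Real.mul_rpow (sq_nonneg t) (by positivity),
      ← Real.rpow_natCast t 2, ← Real.rpow_mul ht, ← Real.rpow_mul hQ.le]
    congr 2
    · congr 1; rw [hp]; push_cast; field_simp
    · congr 1; rw [hp]; field_simp
  have h3 : (1 + t ^ ((2 - γ) * β)) ^ p ≤ 2 ^ p * (1 + t ^ β) := by
    have h := one_add_rpow_le htb hp0.le
    have e : (t ^ ((2 - γ) * β)) ^ p = t ^ β := by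
      rw [← Real.rpow_mul ht, hp]; congr 1; field_simp
    rwa [e] at h
  have h2p : (0 : ℝ) ≤ 2 ^ p := by positivity
  have h4 : (4 : ℝ) ^ p = 2 ^ p * 2 ^ p := by
    rw [show (4 : ℝ) = 2 * 2 by norm_num, Real.mul_rpow (by norm_num) (by norm_num)]
  have htp : 0 ≤ t ^ (2 / (2 - γ)) := Real.rpow_nonneg ht _
  have htβ : 0 ≤ t ^ β := Real.rpow_nonneg ht _
  have hQp : 0 ≤ Q ^ (γ / (2 - γ)) := Real.rpow_nonneg hQ.le _
  have h12p : (1 : ℝ) ≤ 2 ^ p := Real.one_le_rpow (by norm_num) hp0.le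
  set G := 1 + t ^ (2 / (2 - γ)) * (1 + t ^ β) * Q ^ (γ / (2 - γ)) with hG
  calc (1 + t ^ 2 * (1 + t ^ ((2 - γ) * β)) * Q ^ γ) ^ p
      ≤ 2 ^ p * (1 + (t ^ 2 * (1 + t ^ ((2 - γ) * β)) * Q ^ γ) ^ p) := h1
    _ = 2 ^ p * (1 + t ^ (2 / (2 - γ)) * (1 + t ^ ((2 - γ) * β)) ^ p * Q ^ (γ / (2 - γ))) := by rw [h2]
    _ ≤ 2 ^ p * (1 + t ^ (2 / (2 - γ)) * (2 ^ p * (1 + t ^ β)) * Q ^ (γ / (2 - γ))) := by gcongr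
    _ ≤ 2 ^ p * (2 ^ p * G) := by
        refine mul_le_mul_of_nonneg_left ?_ h2p
        rw [hG]
        have : 0 ≤ t ^ (2 / (2 - γ)) * (1 + t ^ β) * Q ^ (γ / (2 - γ)) := by positivity
        nlinarith
    _ = 4 ^ p * G := by rw [h4]; ring

/-- **The main term of the growth estimate**: `3 W_{μ,n_k^*+1}(x) ≤ (2k+1) · 3(9+A)F · Q G` when
`W ≤ Q(2n_k^*+3)`, `n_k^* < 2k + 3 + AXL`, `L < k`, `1 ≤ X ≤ F G`. Pure real arithmetic.
[cite: ButtaMarchioro2016, §3 (end of the proof of Thm 2.1)] -/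
theorem growth_main_le {Y Q A X L G F k n : ℝ} (hQ0 : 0 ≤ Q) (hA0 : 0 ≤ A) (hX1 : 1 ≤ X)
    (hL0 : 0 ≤ L) (hLk : L < k) (hXG : X ≤ F * G)
    (hY : Y ≤ Q * (2 * n + 3)) (hn : n < 2 * k + 3 + A * X * L) :
    3 * Y ≤ (2 * k + 1) * (3 * (9 + A) * F * Q * G) := by
  have hX0 : 0 ≤ X := zero_le_one.trans hX1
  have hk0 : 0 ≤ k := hL0.trans hLk.le
  have hAX : A * X * L ≤ A * X * k := mul_le_mul_of_nonneg_left hLk.le (by positivity)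
  have h2 : 2 * n + 3 ≤ (2 * k + 1) * (9 + A * X) := by nlinarith [mul_nonneg hA0 hX0]
  have h4 : 9 + A * X ≤ (9 + A) * (F * G) := by nlinarith
  calc 3 * Y ≤ 3 * (Q * (2 * n + 3)) := by linarith
    _ ≤ 3 * (Q * ((2 * k + 1) * (9 + A * X))) := by gcongr
    _ ≤ 3 * (Q * ((2 * k + 1) * ((9 + A) * (F * G)))) := by gcongr
    _ = (2 * k + 1) * (3 * (9 + A) * F * Q * G) := by ring

/-- Kinetic terms of nearby momenta: `p²/2 ≤ p'²/2 + e (a + e)` if `|p'| ≤ a`, `|p - p'| ≤ e`.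
[folklore] -/
theorem sq_half_le_of_abs_sub_le {p p' a e : ℝ} (ha : 0 ≤ a) (hp' : |p'| ≤ a)
    (h : |p - p'| ≤ e) : p ^ 2 / 2 ≤ p' ^ 2 / 2 + e * (a + e) := by
  have h1 : |p' * (p - p')| ≤ a * e := by
    rw [abs_mul]; exact mul_le_mul hp' h (abs_nonneg _) ha
  have h2 : (p - p') ^ 2 ≤ e ^ 2 := by
    rw [← sq_abs]; exact pow_le_pow_left₀ (abs_nonneg _) h 2
  have h3 := le_abs_self (p' * (p - p'))
  nlinarith

-- a long assembly proof (many hypotheses in context): the default heartbeat budget is exceeded by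
-- bookkeeping alone, hence the raised limit for this one declaration
set_option maxHeartbeats 800000 in
/-- **The growth estimate (2.7)** (BM §3, from (3.16) to the end of the proof of Thm 2.1, `d = 1`):
for `γ ∈ (η, 2)` and `β > 0` there is `C > 0` such that for `x ∈ 𝒳₀`, `t ≥ 0` and `|s| ≤ t`, the limit
configuration `Φ_s(x)` lies in `𝒳₀` with
`Q(Φ_s(x)) ≤ C Q(x) [1 + t^{2/(2-γ)} (1 + t^β) Q(x)^{γ/(2-γ)}]`. Proof as printed: compare
`W_{μ,k}(Φ_s x)` with `W_{μ,k}` of the partial dynamics of size `n_k^*` (energy conservation,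
`W_{μ,n_k^*+1}(x) ≤ Q(x)(2n_k^*+3)`), the difference being controlled by the convergence rate and the
Lipschitz constants of `p²/2`, `U`, `V` near the energy level. [cite: ButtaMarchioro2016, §2 Thm 2.1 eq. (2.7) and §3] -/
theorem growth_bound (hs₁ : 1 ≤ s₁) (hs₂ : 1 ≤ s₂) (hU1 : IsEvenPolyOfDegree P.U s₁)
    (hV1 : IsEvenPolyOfDegree P.V s₂) (hB1 : P.CondB1) {Φ : ℝ → ChainConfig → ChainConfig}
    (hΦ : ∀ x ∈ P.bmGood, ∀ (s : ℝ) (i : ℤ),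
      Tendsto (fun n : ℕ => severedFlow hB1 (Finset.Icc ((0 : ℤ) - n) ((0 : ℤ) + n)) s x i) atTop
        (𝓝 (Φ s x i)))
    {γ β : ℝ} (hγ : (((max s₁ s₂ : ℕ) : ℝ) - 1) / ((max s₁ s₂ : ℕ) : ℝ) < γ) (hγ2 : γ < 2)
    (hβ : 0 < β) :
    ∃ C : ℝ, 0 < C ∧ ∀ x ∈ P.bmGood, ∀ t : ℝ, 0 ≤ t → ∀ s : ℝ, |s| ≤ t →
      Φ s x ∈ P.bmGood ∧ P.bmGrowth (Φ s x) ≤ C * P.bmGrowth x *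
        (1 + t ^ (2 / (2 - γ)) * (1 + t ^ β) * P.bmGrowth x ^ (γ / (2 - γ))) := by
  have hU : ContDiff ℝ 2 P.U := hU1.contDiff_two
  have hV : ContDiff ℝ 2 P.V := hV1.contDiff_two
  have hU0 : ∀ r, 0 ≤ P.U r := hU1.choose_spec.2.2
  have hV0 : ∀ r, 0 ≤ P.V r := hV1.choose_spec.2.2
  have hVe : ∀ r, P.V (-r) = P.V r := fun r => congrFun hV1.comp_neg r
  have hS1 : (1 : ℝ) ≤ ((max s₁ s₂ : ℕ) : ℝ) := by exact_mod_cast le_max_of_le_left hs₁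
  have hS0 : (0 : ℝ) < ((max s₁ s₂ : ℕ) : ℝ) := by linarith
  have hη1 : (((max s₁ s₂ : ℕ) : ℝ) - 1) / ((max s₁ s₂ : ℕ) : ℝ) ≤ 1 := by
    rw [div_le_one hS0]; linarith
  have hη0 : 0 ≤ (((max s₁ s₂ : ℕ) : ℝ) - 1) / ((max s₁ s₂ : ℕ) : ℝ) :=
    div_nonneg (by linarith) hS0.le
  have h2γ : 0 < 2 - γ := by linarith
  have hγ0 : 0 < γ := hη0.trans_lt hγ
  have hβ'0 : 0 < (2 - γ) * β := by positivity
  obtain ⟨A, K, hA1, hK0, hrate⟩ := dist_limit_le hs₁ hs₂ hU1 hV1 hB1 hΦ hγ hγ2 hβ'0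
  obtain ⟨K₁, K₂, hK₁0, hK₂1, -, -, -, hLipU, hLipV⟩ := exists_constants hs₁ hs₂ hU1 hV1
  have hA0 : 0 ≤ A := zero_le_one.trans hA1
  have hK₂0 : 0 ≤ K₂ := zero_le_one.trans hK₂1
  have hF0 : (0 : ℝ) ≤ 4 ^ (1 / (2 - γ)) := by positivity
  refine ⟨3 * (9 + A) * 4 ^ (1 / (2 - γ)) + (64 * K + 256 * K ^ 2 + 30 * K₂), by positivity, ?_⟩
  intro x hx t ht s hs
  have hQ1 : 1 ≤ P.bmGrowth x := one_le_bmGrowth hU0 hV0 hx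
  have hQ0 : 0 < P.bmGrowth x := one_pos.trans_le hQ1
  have htb : 0 ≤ t ^ ((2 - γ) * β) := Real.rpow_nonneg ht _
  have hQγ : 0 ≤ P.bmGrowth x ^ γ := Real.rpow_nonneg hQ0.le γ
  -- the scale `X` and the majorant `G`
  obtain ⟨X, hX⟩ : ∃ X : ℝ, X = (1 + t ^ 2 * (1 + t ^ ((2 - γ) * β)) * P.bmGrowth x ^ γ) ^ (1 / (2 - γ)) :=
    ⟨_, rfl⟩
  obtain ⟨G, hG⟩ : ∃ G : ℝ, G = 1 + t ^ (2 / (2 - γ)) * (1 + t ^ β) * P.bmGrowth x ^ (γ / (2 - γ)) :=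
    ⟨_, rfl⟩
  have hBx1 : 1 ≤ 1 + t ^ 2 * (1 + t ^ ((2 - γ) * β)) * P.bmGrowth x ^ γ := by
    have : 0 ≤ t ^ 2 * (1 + t ^ ((2 - γ) * β)) * P.bmGrowth x ^ γ := by positivity
    linarith
  have hX1 : 1 ≤ X := by rw [hX]; exact Real.one_le_rpow hBx1 (by positivity)
  have hX0 : 0 < X := one_pos.trans_le hX1
  have hXpow : 1 + t ^ 2 * P.bmGrowth x ^ γ ≤ X ^ (2 - γ) := by
    rw [hX, ← Real.rpow_mul (by positivity), one_div_mul_cancel h2γ.ne', Real.rpow_one]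
    have : t ^ 2 * P.bmGrowth x ^ γ ≤ t ^ 2 * (1 + t ^ ((2 - γ) * β)) * P.bmGrowth x ^ γ := by
      have h1 : t ^ 2 ≤ t ^ 2 * (1 + t ^ ((2 - γ) * β)) := by nlinarith [sq_nonneg t]
      exact mul_le_mul_of_nonneg_right h1 hQγ
    linarith
  have hG1 : 1 ≤ G := by
    rw [hG]
    have : 0 ≤ t ^ (2 / (2 - γ)) * (1 + t ^ β) * P.bmGrowth x ^ (γ / (2 - γ)) := by
      have := Real.rpow_nonneg ht (2 / (2 - γ))
      have := Real.rpow_nonneg ht β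
      have := Real.rpow_nonneg hQ0.le (γ / (2 - γ))
      positivity
    linarith
  have hXG : X ≤ 4 ^ (1 / (2 - γ)) * G := by
    rw [hX, hG]; exact scale_le_four_rpow_mul ht hQ0 hγ2 hβ
  -- box-wise bound
  have hbox : ∀ (μ : ℤ) (k : ℕ), Real.log (Real.exp 1 + |(μ : ℝ)|) < k →
      P.bmLocalEnergy μ k (Φ s x) / (2 * (k : ℝ) + 1) ≤
        (3 * (9 + A) * 4 ^ (1 / (2 - γ)) + (64 * K + 256 * K ^ 2 + 30 * K₂)) * P.bmGrowth x * G := by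
    intro μ k hLk
    obtain ⟨L, hL⟩ : ∃ L : ℝ, L = Real.log (Real.exp 1 + |(μ : ℝ)|) := ⟨_, rfl⟩
    rw [← hL] at hLk
    have hL1 : 1 ≤ L := by rw [hL]; exact one_le_log_exp_add_abs μ
    have hk0 : (0 : ℝ) < 2 * k + 1 := by positivity
    obtain ⟨nstar, hnstar⟩ : ∃ nstar : ℕ, nstar = ⌈2 * (k : ℝ) + 2 + A * X * L⌉₊ := ⟨_, rfl⟩
    have hAXL0 : 0 ≤ A * X * L := by positivity
    have hn1 : 2 * (k : ℝ) + 2 + A * X * L ≤ nstar := by rw [hnstar]; exact Nat.le_ceil _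
    have hn2 : (nstar : ℝ) < 2 * k + 3 + A * X * L := by
      rw [hnstar]
      have := Nat.ceil_lt_add_one (show 0 ≤ 2 * (k : ℝ) + 2 + A * X * L by positivity)
      linarith
    have hkn : k ≤ nstar := by
      have : (k : ℝ) ≤ nstar := by linarith
      exact_mod_cast this
    obtain ⟨m, hm⟩ : ∃ m : ℕ, m = nstar - k := ⟨_, rfl⟩
    have hmr : (m : ℝ) = nstar - k := by rw [hm, Nat.cast_sub hkn]
    have hm2 : (2 : ℝ) ≤ m := by rw [hmr]; linarith
    have hkm : (k : ℝ) ≤ m := by rw [hmr]; linarith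
    have hLm : L ≤ m := by linarith
    have hXm : X ≤ m := by
      have h1 : A * X * L ≤ m := by rw [hmr]; linarith
      have h2 : X ≤ A * X := le_mul_of_one_le_left hX0.le hA1
      have h3 : A * X ≤ A * X * L := le_mul_of_one_le_right (by positivity) hL1
      linarith
    -- energy level of the partial dynamics of size `n*`
    have hY1 : 1 ≤ P.bmLocalEnergy μ (nstar + 1) x := one_le_bmLocalEnergy hU0 hV0 μ _ x
    have hYle : P.bmLocalEnergy μ (nstar + 1) x ≤ P.bmGrowth x * (2 * nstar + 3) := by
      have hlt : Real.log (Real.exp 1 + |(μ : ℝ)|) < ((nstar + 1 : ℕ) : ℝ) := by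
        rw [← hL]; push_cast; linarith
      have h := bmLocalEnergy_le_of_lt hx hlt
      push_cast at h; linarith
    have hYm : P.bmLocalEnergy μ (nstar + 1) x ≤ 6 * P.bmGrowth x * m := by
      have : 2 * (nstar : ℝ) + 3 ≤ 6 * m := by linarith
      calc P.bmLocalEnergy μ (nstar + 1) x ≤ P.bmGrowth x * (2 * nstar + 3) := hYle
        _ ≤ P.bmGrowth x * (6 * m) := mul_le_mul_of_nonneg_left this hQ0.le
        _ = 6 * P.bmGrowth x * m := by ring
    have hE := severedFlow_energy_bounds hU hV hU0 hV0 hB1 hVe μ nstar x s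
    have hn1' := hn1
    rw [hX, hL] at hn1'
    have hR := hrate x hx μ t ht k nstar hn1'
    -- opaque names: `Qη = Q^η`, `y*` the partial dynamics at time `s`, `Y` the energy level
    obtain ⟨Qη, hQη'⟩ : ∃ Qη : ℝ, Qη = P.bmGrowth x ^ ((((max s₁ s₂ : ℕ) : ℝ) - 1) / ((max s₁ s₂ : ℕ) : ℝ)) :=
      ⟨_, rfl⟩
    have hQη : 0 ≤ Qη := by rw [hQη']; exact Real.rpow_nonneg hQ0.le _
    obtain ⟨ystar, hystar⟩ : ∃ ystar : ChainConfig,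
        ystar = severedFlow hB1 (Finset.Icc (μ - nstar) (μ + nstar)) s x := ⟨_, rfl⟩
    rw [← hystar] at hE
    obtain ⟨hEsite, -, hEW⟩ := hE
    obtain ⟨Y, hY⟩ : ∃ Y : ℝ, Y = P.bmLocalEnergy μ (nstar + 1) x := ⟨_, rfl⟩
    rw [← hY] at hY1 hYle hYm hEsite hEW
    have hY0 : 0 ≤ Y := zero_le_one.trans hY1
    -- the error sizes
    obtain ⟨εq, hεq⟩ : ∃ εq : ℝ, εq = 2 * (1 / 64) ^ (nstar + 1 - k) := ⟨_, rfl⟩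
    obtain ⟨εp, hεp⟩ : ∃ εp : ℝ, εp = 2 * (t * K * Qη * (2 * k + 2 * L + 7) * (1 / 32) ^ (nstar - k)) :=
      ⟨_, rfl⟩
    have hεq0 : 0 ≤ εq := by rw [hεq]; positivity
    have hεp0 : 0 ≤ εp := by rw [hεp]; positivity
    have hεq1 : εq ≤ (1 / 64) ^ m := by
      rw [hεq, show nstar + 1 - k = m + 1 by omega, pow_succ]
      have : (0 : ℝ) ≤ (1 / 64) ^ m := by positivity
      nlinarith
    have hεqhalf : εq ≤ 1 / 2 := by
      have hm0 : m ≠ 0 := by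
        intro h
        have : (m : ℝ) = 0 := by exact_mod_cast h
        linarith
      have : ((1 : ℝ) / 64) ^ m ≤ 1 / 64 := pow_le_of_le_one (by norm_num) (by norm_num) hm0
      linarith
    have hεp1 : εp ≤ 16 * t * K * Qη * m * (1 / 32) ^ m := by
      rw [hεp, ← hm]
      have hb : 2 * (k : ℝ) + 2 * L + 7 ≤ 8 * m := by linarith
      have h0 : 0 ≤ t * K * Qη := by positivity
      have h1 : (0 : ℝ) ≤ (1 / 32) ^ m := by positivity
      have h2 := mul_le_mul_of_nonneg_right (mul_le_mul_of_nonneg_left hb h0) h1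
      linarith
    have hRq : ∀ j ∈ Finset.Icc (μ - k) (μ + k), |(Φ s x j).1 - (ystar j).1| ≤ εq := fun j hj => by
      rw [hεq, hystar]; exact (hR j hj s hs).1
    have hRp : ∀ j ∈ Finset.Icc (μ - k) (μ + k), |(Φ s x j).2 - (ystar j).2| ≤ εp := fun j hj => by
      rw [hεp, hystar, hQη', hL]; exact (hR j hj s hs).2
    -- site and pair comparisons
    have hkn' : Finset.Icc (μ - k) (μ + k) ⊆ Finset.Icc (μ - nstar) (μ + nstar) := cbox_subset hkn
    have hsite : ∀ j ∈ Finset.Icc (μ - k) (μ + k),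
        (Φ s x j).2 ^ 2 / 2 + P.U (Φ s x j).1 ≤ (ystar j).2 ^ 2 / 2 + P.U (ystar j).1 +
          (εp * (Real.sqrt (2 * Y) + εp) + K₂ * Y * εq) := by
      intro j hj
      have hjn := hkn' hj
      have hp' : |(ystar j).2| ≤ Real.sqrt (2 * Y) := by
        have h := (hEsite j hjn).1
        calc |(ystar j).2| = Real.sqrt ((ystar j).2 ^ 2) := (Real.sqrt_sq_eq_abs _).symm
          _ ≤ Real.sqrt (2 * Y) := Real.sqrt_le_sqrt (by linarith)
      have ha := hRp j hj
      have hmom : (Φ s x j).2 ^ 2 / 2 ≤ (ystar j).2 ^ 2 / 2 + εp * (Real.sqrt (2 * Y) + εp) :=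
        sq_half_le_of_abs_sub_le (Real.sqrt_nonneg _) hp' ha
      have hpin : P.U (Φ s x j).1 ≤ P.U (ystar j).1 + K₂ * Y * εq := by
        have hq' := hRq j hj
        have h := hLipU Y (ystar j).1 (Φ s x j).1 hY1 (hEsite j hjn).2
          (by rw [abs_sub_comm]; linarith)
        have h' : |P.U (ystar j).1 - P.U (Φ s x j).1| ≤ K₂ * Y * εq := by
          refine h.trans (mul_le_mul_of_nonneg_left ?_ (by positivity))
          rw [abs_sub_comm]; exact hq'
        have := (abs_sub_le_iff.1 h').2
        linarith
      linarith
    have hpair : ∀ j ∈ Finset.Icc (μ - k) (μ + k), ∀ j' ∈ Finset.Icc (μ - k) (μ + k), |j' - j| = 1 →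
        P.V ((Φ s x j).1 - (Φ s x j').1) ≤ P.V ((ystar j).1 - (ystar j').1) + 2 * K₂ * Y * εq := by
      intro j hj j' hj' hjj'
      have hjn := hkn' hj
      have hjn' := hkn' hj'
      have hV3 : P.V ((ystar j).1 - (ystar j').1) ≤ 3 * Y := by
        rcases abs_eq (zero_le_one' ℤ) |>.1 hjj' with h | h
        · have e : j' = j + 1 := by omega
          subst e
          rw [← hVe, neg_sub]
          have hb := bond_le_bmLocalEnergy hU0 hV0 ystar hjn' (by simpa using hjn)
          simp only [add_sub_cancel_right] at hb
          exact hb.trans hEW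
        · have e : j' = j - 1 := by omega
          subst e
          exact (bond_le_bmLocalEnergy hU0 hV0 ystar hjn hjn').trans hEW
      have hd : |((ystar j).1 - (ystar j').1) - ((Φ s x j).1 - (Φ s x j').1)| ≤ 2 * εq := by
        calc |((ystar j).1 - (ystar j').1) - ((Φ s x j).1 - (Φ s x j').1)|
            = |((Φ s x j').1 - (ystar j').1) - ((Φ s x j).1 - (ystar j).1)| := by ring_nf
          _ ≤ |(Φ s x j').1 - (ystar j').1| + |(Φ s x j).1 - (ystar j).1| := abs_sub _ _
          _ ≤ εq + εq := add_le_add (hRq j' hj') (hRq j hj)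
          _ = 2 * εq := by ring
      have h := hLipV Y _ ((Φ s x j).1 - (Φ s x j').1) hY1 hV3 (hd.trans (by linarith))
      have h' : |P.V ((ystar j).1 - (ystar j').1) - P.V ((Φ s x j).1 - (Φ s x j').1)| ≤
          2 * K₂ * Y * εq := by
        refine h.trans ?_
        calc K₂ * Y * |((ystar j).1 - (ystar j').1) - ((Φ s x j).1 - (Φ s x j').1)|
            ≤ K₂ * Y * (2 * εq) := mul_le_mul_of_nonneg_left hd (by positivity)
          _ = 2 * K₂ * Y * εq := by ring
      have := (abs_le.1 h').1
      linarith
    have hδ₂0 : 0 ≤ 2 * K₂ * Y * εq := by positivity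
    have hcmp := bmLocalEnergy_le_add μ k (Φ s x) ystar hδ₂0 hsite hpair
    have hWy : P.bmLocalEnergy μ k ystar ≤ 3 * Y := (bmLocalEnergy_mono hU0 hV0 μ hkn ystar).trans hEW
    -- the two arithmetic lemmas
    rw [hQη'] at hεp1
    have herr := growth_err_le (K := K) (K₂ := K₂) (Q := P.bmGrowth x)
      (η := (((max s₁ s₂ : ℕ) : ℝ) - 1) / ((max s₁ s₂ : ℕ) : ℝ)) (γ := γ) (X := X) (Y := Y)
      ht hK0 hK₂0 hQ1 (by linarith) hγ0.le hX1 hXpow hXm hm2 hYm hεq0 hεq1 hεp0 hεp1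
    have hmainY := growth_main_le (Y := Y) (F := (4 : ℝ) ^ (1 / (2 - γ))) hQ0.le hA0 hX1
      (zero_le_one.trans hL1) hLk hXG hYle hn2
    have hGQ : (64 * K + 256 * K ^ 2 + 30 * K₂) * P.bmGrowth x ≤
        (64 * K + 256 * K ^ 2 + 30 * K₂) * P.bmGrowth x * G := le_mul_of_one_le_right (by positivity) hG1
    rw [div_le_iff₀ hk0]
    have hk1 : (1 : ℝ) ≤ 2 * k + 1 := by linarith [hk0]
    have hfin : P.bmLocalEnergy μ k (Φ s x) ≤
        (2 * k + 1) * (3 * (9 + A) * 4 ^ (1 / (2 - γ)) * P.bmGrowth x * G) +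
          (2 * k + 1) * ((64 * K + 256 * K ^ 2 + 30 * K₂) * P.bmGrowth x * G) := by
      calc P.bmLocalEnergy μ k (Φ s x)
          ≤ P.bmLocalEnergy μ k ystar + (2 * k + 1) * ((εp * (Real.sqrt (2 * Y) + εp) + K₂ * Y * εq) +
              2 * (2 * K₂ * Y * εq)) := hcmp
        _ ≤ 3 * Y + (2 * k + 1) * ((64 * K + 256 * K ^ 2 + 30 * K₂) * P.bmGrowth x * G) := by
            have := mul_le_mul_of_nonneg_left (herr.trans hGQ) hk0.le
            linarith
        _ ≤ _ := by linarith
    calc P.bmLocalEnergy μ k (Φ s x) ≤ _ := hfin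
      _ = (3 * (9 + A) * 4 ^ (1 / (2 - γ)) + (64 * K + 256 * K ^ 2 + 30 * K₂)) * P.bmGrowth x * G *
            (2 * (k : ℝ) + 1) := by ring
  have hres := mem_bmGood_of_le hbox
  rw [hG] at hres
  exact hres

end Growth

/-! ### §10 Group law, the Baire-category upgrade of uniqueness, and the assembly of Thm 2.1 -/

section Assembly

variable {P : OscillatorChain} {s₁ s₂ : ℕ}

/-- A solution of the equations of motion is continuous as a curve in the product space. [folklore] -/
theorem IsSolution.continuous_curve {γ : ℝ → ChainConfig} (hγ : P.IsSolution γ) : Continuous γ := by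
  apply continuous_pi
  intro i
  have h1 : Continuous fun t => (γ t i).1 := continuous_iff_continuousAt.2 fun t => (hγ i t).1.continuousAt
  have h2 : Continuous fun t => (γ t i).2 := continuous_iff_continuousAt.2 fun t => (hγ i t).2.continuousAt
  exact h1.prodMk h2

/-- Along a continuous curve the local energies `W_{μ,k}` are continuous in time (`U`, `V` continuous).
[folklore] -/
theorem continuous_bmLocalEnergy_comp (hUc : Continuous P.U) (hVc : Continuous P.V) {γ : ℝ → ChainConfig}
    (hγ : Continuous γ) (μ : ℤ) (k : ℕ) : Continuous fun t => P.bmLocalEnergy μ k (γ t) := by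
  have hq : ∀ i : ℤ, Continuous fun t => (γ t i).1 := fun i =>
    continuous_fst.comp ((continuous_apply i).comp hγ)
  have hp : ∀ i : ℤ, Continuous fun t => (γ t i).2 := fun i =>
    continuous_snd.comp ((continuous_apply i).comp hγ)
  unfold bmLocalEnergy
  refine (continuous_finsetSum _ fun i _ => ?_).add
    (continuous_finsetSum _ fun i _ => continuous_finsetSum _ fun j _ => ?_)
  · exact ((((hp i).pow 2).div_const 2).add (hUc.comp (hq i))).add continuous_const
  · by_cases h : |j - i| = 1
    · simp only [if_pos h]; exact hVc.comp ((hq i).sub (hq j))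
    · simp only [if_neg h]; exact continuous_const

/-- **The group law `Φ_{t+s} = Φ_t ∘ Φ_s` on `𝒳₀`**, from uniqueness in the locally-bounded-`Q` class:
both `r ↦ Φ_{r+s}(y)` and `r ↦ Φ_r(Φ_s y)` solve (2.1) from `Φ_s y` with locally bounded `Q`.
[cite: ButtaMarchioro2016, §2 Thm 2.1 ("one-parameter group")] -/
theorem flow_add_of_bounds (hs₁ : 1 ≤ s₁) (hs₂ : 1 ≤ s₂) (hU1 : IsEvenPolyOfDegree P.U s₁)
    (hV1 : IsEvenPolyOfDegree P.V s₂) {Φ : ℝ → ChainConfig → ChainConfig}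
    (hΦsol : ∀ y ∈ P.bmGood, P.IsSolution fun s => Φ s y) (hΦ0 : ∀ y ∈ P.bmGood, Φ 0 y = y)
    (hΦbd : ∀ y ∈ P.bmGood, ∀ T : ℝ, 0 ≤ T → ∃ N : ℝ, ∀ s, |s| ≤ T →
      Φ s y ∈ P.bmGood ∧ P.bmGrowth (Φ s y) ≤ N)
    (t s : ℝ) {y : ChainConfig} (hy : y ∈ P.bmGood) : Φ (t + s) y = Φ t (Φ s y) := by
  obtain ⟨N₀, hN₀⟩ := hΦbd y hy |s| (abs_nonneg s)
  have hy' : Φ s y ∈ P.bmGood := (hN₀ s le_rfl).1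
  obtain ⟨N₁, hN₁⟩ := hΦbd y hy (|t| + |s|) (by positivity)
  obtain ⟨N₂, hN₂⟩ := hΦbd (Φ s y) hy' |t| (abs_nonneg t)
  have ha : P.IsSolution fun r => Φ (r + s) y := (hΦsol y hy).comp_add_const s
  have hb : P.IsSolution fun r => Φ r (Φ s y) := hΦsol _ hy'
  have h0 : (fun r => Φ (r + s) y) 0 = (fun r => Φ r (Φ s y)) 0 := by
    simp only [zero_add]; rw [hΦ0 _ hy']
  have key := eq_of_isSolution_of_bmGrowth_le hs₁ hs₂ hU1 hV1 ha hb h0 (t := |t|) (N := max N₁ N₂)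
    (fun r hr => by
      have h := hN₁ (r + s) ((abs_add_le r s).trans (by linarith))
      exact ⟨h.1, h.2.trans (le_max_left _ _)⟩)
    (fun r hr => by
      have h := hN₂ r hr
      exact ⟨h.1, h.2.trans (le_max_right _ _)⟩)
    t le_rfl
  exact key

/-- **Local uniqueness at a time of locally bounded `Q`**: if `γ` solves (2.1) with values in `𝒳₀`
and `Q(γ(s))` is bounded near `t`, then `γ(t + r) = Φ_r(γ(t))` for small `|r|`. [cite: ButtaMarchioro2016, §2 Thm 2.1 (uniqueness)] -/
theorem local_flow_eq (hs₁ : 1 ≤ s₁) (hs₂ : 1 ≤ s₂) (hU1 : IsEvenPolyOfDegree P.U s₁)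
    (hV1 : IsEvenPolyOfDegree P.V s₂) {Φ : ℝ → ChainConfig → ChainConfig}
    (hΦsol : ∀ y ∈ P.bmGood, P.IsSolution fun s => Φ s y) (hΦ0 : ∀ y ∈ P.bmGood, Φ 0 y = y)
    (hΦbd : ∀ y ∈ P.bmGood, ∀ T : ℝ, 0 ≤ T → ∃ N : ℝ, ∀ s, |s| ≤ T →
      Φ s y ∈ P.bmGood ∧ P.bmGrowth (Φ s y) ≤ N)
    {γ : ℝ → ChainConfig} (hγ : P.IsSolution γ) (hγg : ∀ t, γ t ∈ P.bmGood) {t ε N : ℝ} (hε : 0 < ε)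
    (hN : ∀ s, |s - t| < ε → P.bmGrowth (γ s) ≤ N) :
    ∀ r, |r| ≤ ε / 2 → γ (t + r) = Φ r (γ t) := by
  obtain ⟨N₂, hN₂⟩ := hΦbd (γ t) (hγg t) (ε / 2) (by positivity)
  have ha : P.IsSolution fun r => γ (r + t) := hγ.comp_add_const t
  have hb : P.IsSolution fun r => Φ r (γ t) := hΦsol _ (hγg t)
  have h0 : (fun r => γ (r + t)) 0 = (fun r => Φ r (γ t)) 0 := by
    simp only [zero_add]; rw [hΦ0 _ (hγg t)]
  have key := eq_of_isSolution_of_bmGrowth_le hs₁ hs₂ hU1 hV1 ha hb h0 (t := ε / 2) (N := max N N₂)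
    (fun r hr => ⟨hγg _, (hN (r + t) (by rw [add_sub_cancel_right]; linarith)).trans (le_max_left _ _)⟩)
    (fun r hr => ⟨(hN₂ r hr).1, (hN₂ r hr).2.trans (le_max_right _ _)⟩)
  intro r hr
  have h : γ (r + t) = Φ r (γ t) := key r hr
  rwa [add_comm] at h

/-- **Propagation along an interval of times of locally bounded `Q`**: if every point of the open
interval `(a, b)` has a neighbourhood on which `Q ∘ γ` is bounded and `t₀ ∈ (a, b)`, then
`γ(c) = Φ_{c-t₀}(γ(t₀))` for every `c ∈ [a, b]` (clopen argument in the connected interval, local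
uniqueness + group law; endpoints by continuity), and conversely `γ(t₀) = Φ_{t₀-c}(γ(c))`.
[cite: ButtaMarchioro2016, §2 Thm 2.1 (uniqueness)] -/
theorem flow_eq_on_good_interval (hs₁ : 1 ≤ s₁) (hs₂ : 1 ≤ s₂) (hU1 : IsEvenPolyOfDegree P.U s₁)
    (hV1 : IsEvenPolyOfDegree P.V s₂) {Φ : ℝ → ChainConfig → ChainConfig}
    (hΦsol : ∀ y ∈ P.bmGood, P.IsSolution fun s => Φ s y) (hΦ0 : ∀ y ∈ P.bmGood, Φ 0 y = y)
    (hΦbd : ∀ y ∈ P.bmGood, ∀ T : ℝ, 0 ≤ T → ∃ N : ℝ, ∀ s, |s| ≤ T →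
      Φ s y ∈ P.bmGood ∧ P.bmGrowth (Φ s y) ≤ N)
    (hgrp : ∀ t s : ℝ, ∀ y ∈ P.bmGood, Φ (t + s) y = Φ t (Φ s y))
    {γ : ℝ → ChainConfig} (hγ : P.IsSolution γ) (hγg : ∀ t, γ t ∈ P.bmGood) {a b t₀ : ℝ}
    (ht₀ : t₀ ∈ Ioo a b)
    (hgood : ∀ t ∈ Ioo a b, ∃ ε > 0, ∃ N : ℝ, ∀ s, |s - t| < ε → P.bmGrowth (γ s) ≤ N) :
    ∀ c ∈ Icc a b, γ c = Φ (c - t₀) (γ t₀) ∧ γ t₀ = Φ (t₀ - c) (γ c) := by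
  have hab : a < b := ht₀.1.trans ht₀.2
  -- continuity of both sides
  have hcγ : Continuous γ := IsSolution.continuous_curve hγ
  have hcΦ : Continuous fun s => Φ (s - t₀) (γ t₀) :=
    (IsSolution.continuous_curve (hΦsol _ (hγg t₀))).comp (continuous_id.sub continuous_const)
  set E : Set ℝ := {s | γ s = Φ (s - t₀) (γ t₀)} with hE
  have hEc : IsClosed E := isClosed_eq hcγ hcΦ
  set u : Set ℝ := Ioo a b ∩ E with hu
  -- `u` is open: local uniqueness at its points, then the group law
  have huo : IsOpen u := by
    rw [Metric.isOpen_iff]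
    rintro s ⟨hsI, hsE⟩
    obtain ⟨ε, hε, N, hN⟩ := hgood s hsI
    have hloc := local_flow_eq hs₁ hs₂ hU1 hV1 hΦsol hΦ0 hΦbd hγ hγg hε hN
    set δ : ℝ := min (ε / 2) (min (s - a) (b - s)) with hδ
    have hδ0 : 0 < δ := by
      rw [hδ]; exact lt_min (by positivity) (lt_min (by linarith [hsI.1]) (by linarith [hsI.2]))
    refine ⟨δ, hδ0, fun s' hs' => ?_⟩
    rw [Metric.mem_ball, Real.dist_eq] at hs'
    have h1 : |s' - s| < ε / 2 := lt_of_lt_of_le hs' (min_le_left _ _)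
    have h2 : |s' - s| < s - a := lt_of_lt_of_le hs' ((min_le_right _ _).trans (min_le_left _ _))
    have h3 : |s' - s| < b - s := lt_of_lt_of_le hs' ((min_le_right _ _).trans (min_le_right _ _))
    have hs'I : s' ∈ Ioo a b := by
      constructor <;> cases abs_lt.1 h2 <;> cases abs_lt.1 h3 <;> linarith
    refine ⟨hs'I, ?_⟩
    show γ s' = Φ (s' - t₀) (γ t₀)
    have e1 : γ s' = Φ (s' - s) (γ s) := by
      have := hloc (s' - s) h1.le
      rwa [add_sub_cancel] at this
    rw [e1, show γ s = Φ (s - t₀) (γ t₀) from hsE, ← hgrp _ _ _ (hγg t₀)]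
    congr 1; ring
  -- the clopen argument in the connected interval
  have hsub : Ioo a b ⊆ u := by
    refine (isPreconnected_Ioo).subset_of_closure_inter_subset huo ⟨t₀, ht₀, ht₀, ?_⟩ ?_
    · show γ t₀ = Φ (t₀ - t₀) (γ t₀)
      rw [sub_self, hΦ0 _ (hγg t₀)]
    · rintro s ⟨hs1, hs2⟩
      refine ⟨hs2, ?_⟩
      have : closure u ⊆ E := (closure_mono Set.inter_subset_right).trans (hEc.closure_subset)
      exact this hs1
  -- endpoints by continuity
  have hEq : EqOn γ (fun s => Φ (s - t₀) (γ t₀)) (Icc a b) := by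
    have h1 : EqOn γ (fun s => Φ (s - t₀) (γ t₀)) (Ioo a b) := fun s hs => (hsub hs).2
    have h2 := h1.closure hcγ hcΦ
    rwa [closure_Ioo hab.ne] at h2
  intro c hc
  have h1 : γ c = Φ (c - t₀) (γ t₀) := hEq hc
  refine ⟨h1, ?_⟩
  rw [h1, ← hgrp _ _ _ (hγg t₀), show t₀ - c + (c - t₀) = 0 by ring, hΦ0 _ (hγg t₀)]

/-- The set of times near which a real function is bounded is open. [folklore] -/
theorem isOpen_locallyBounded (f : ℝ → ℝ) :
    IsOpen {t : ℝ | ∃ ε > 0, ∃ N : ℝ, ∀ s, |s - t| < ε → f s ≤ N} := by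
  rw [Metric.isOpen_iff]
  rintro t ⟨ε, hε, N, hN⟩
  refine ⟨ε / 2, by positivity, fun t' ht' => ⟨ε / 2, by positivity, N, fun s hs => hN s ?_⟩⟩
  rw [Metric.mem_ball, Real.dist_eq] at ht'
  calc |s - t| = |(s - t') + (t' - t)| := by ring_nf
    _ ≤ |s - t'| + |t' - t| := abs_add_le _ _
    _ < ε / 2 + ε / 2 := add_lt_add hs ht'
    _ = ε := by ring

/-- **Baire step**: a non-empty closed set of reals covered by countably many closed sets contains a
relatively open piece inside one of them. [folklore] -/
theorem exists_baire_piece {B : Set ℝ} (hBc : IsClosed B) {t : ℝ} (ht : t ∈ B) {A : ℕ → Set ℝ}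
    (hAc : ∀ N, IsClosed (A N)) (hcov : ∀ x, ∃ N, x ∈ A N) :
    ∃ (N : ℕ) (t₁ : ℝ), t₁ ∈ B ∧ ∃ δ > 0, ∀ t' ∈ B, |t' - t₁| < δ → t' ∈ A N := by
  haveI : CompleteSpace B := hBc.completeSpace_coe
  haveI : Nonempty B := ⟨⟨t, ht⟩⟩
  have hFc : ∀ N, IsClosed ((Subtype.val : B → ℝ) ⁻¹' A N) := fun N =>
    (hAc N).preimage continuous_subtype_val
  have hFU : ⋃ N, ((Subtype.val : B → ℝ) ⁻¹' A N) = univ := by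
    ext x
    simp only [mem_iUnion, mem_preimage, mem_univ, iff_true]
    exact hcov x.1
  obtain ⟨N, x₁, hx₁⟩ := nonempty_interior_of_iUnion_of_closed hFc hFU
  rw [mem_interior_iff_mem_nhds, Metric.mem_nhds_iff] at hx₁
  obtain ⟨δ, hδ, hball⟩ := hx₁
  refine ⟨N, x₁.1, x₁.2, δ, hδ, fun t' ht' hd => ?_⟩
  have hmem : (⟨t', ht'⟩ : B) ∈ Metric.ball x₁ δ := by
    rw [Metric.mem_ball, Subtype.dist_eq, Real.dist_eq]; exact hd
  exact hball hmem

/-- **The nearest bad time**: for a closed set `B ∋ t₁` and `s ∉ B` there is `c ∈ B` between `t₁`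
and `s` such that the open interval between `c` and `s` misses `B`. [folklore] -/
theorem exists_nearest_mem {B : Set ℝ} (hBc : IsClosed B) {t₁ s : ℝ} (ht₁ : t₁ ∈ B) (hs : s ∉ B) :
    ∃ c ∈ B, |c - t₁| ≤ |s - t₁| ∧ |s - c| ≤ |s - t₁| ∧
      ((c < s ∧ ∀ x ∈ Ioo c s, x ∉ B) ∨ (s < c ∧ ∀ x ∈ Ioo s c, x ∉ B)) := by
  have hst : s ≠ t₁ := fun h => hs (h ▸ ht₁)
  rcases lt_or_gt_of_ne hst with hlt | hgt
  · -- `s < t₁`: `c = inf (B ∩ [s, t₁])`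
    have hSne : (B ∩ Icc s t₁).Nonempty := ⟨t₁, ht₁, hlt.le, le_rfl⟩
    have hSbdd : BddBelow (B ∩ Icc s t₁) := ⟨s, fun x hx => hx.2.1⟩
    have hSc : IsClosed (B ∩ Icc s t₁) := hBc.inter isClosed_Icc
    have hcS : sInf (B ∩ Icc s t₁) ∈ B ∩ Icc s t₁ := hSc.csInf_mem hSne hSbdd
    have hsc : s ≤ sInf (B ∩ Icc s t₁) := le_csInf hSne fun x hx => hx.2.1
    have hsc' : s < sInf (B ∩ Icc s t₁) := lt_of_le_of_ne hsc fun h => hs (h ▸ hcS.1)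
    refine ⟨sInf (B ∩ Icc s t₁), hcS.1, ?_, ?_, Or.inr ⟨hsc', fun x hx hxB => ?_⟩⟩
    · rw [abs_le, abs_of_neg (by linarith : s - t₁ < 0)]; constructor <;> linarith [hcS.2.2]
    · rw [abs_le, abs_of_neg (by linarith : s - t₁ < 0)]; constructor <;> linarith [hcS.2.2]
    · have : sInf (B ∩ Icc s t₁) ≤ x := csInf_le hSbdd ⟨hxB, hx.1.le, hx.2.le.trans hcS.2.2⟩
      linarith [hx.2]
  · -- `t₁ < s`: `c = sup (B ∩ [t₁, s])`
    have hSne : (B ∩ Icc t₁ s).Nonempty := ⟨t₁, ht₁, le_rfl, hgt.le⟩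
    have hSbdd : BddAbove (B ∩ Icc t₁ s) := ⟨s, fun x hx => hx.2.2⟩
    have hSc : IsClosed (B ∩ Icc t₁ s) := hBc.inter isClosed_Icc
    have hcS : sSup (B ∩ Icc t₁ s) ∈ B ∩ Icc t₁ s := hSc.csSup_mem hSne hSbdd
    have hcs : sSup (B ∩ Icc t₁ s) ≤ s := csSup_le hSne fun x hx => hx.2.2
    have hcs' : sSup (B ∩ Icc t₁ s) < s := lt_of_le_of_ne hcs fun h => hs (h ▸ hcS.1)
    refine ⟨sSup (B ∩ Icc t₁ s), hcS.1, ?_, ?_, Or.inl ⟨hcs', fun x hx hxB => ?_⟩⟩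
    · rw [abs_le, abs_of_pos (by linarith : 0 < s - t₁)]; constructor <;> linarith [hcS.2.1]
    · rw [abs_le, abs_of_pos (by linarith : 0 < s - t₁)]; constructor <;> linarith [hcS.2.1]
    · have : x ≤ sSup (B ∩ Icc t₁ s) := le_csSup hSbdd ⟨hxB, hcS.2.1.trans hx.1.le, hx.2.le⟩
      linarith [hx.1]

/-- The sublevel sets `{t | Q(γ t) ≤ N}` of a `𝒳₀`-valued continuous curve, written as the family of
inequalities `W_{μ,k}(γ t)/(2k+1) ≤ N`, are closed and cover `ℝ`. [folklore] -/
theorem isClosed_sublevel_bmGrowth (hUc : Continuous P.U) (hVc : Continuous P.V) {γ : ℝ → ChainConfig}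
    (hγc : Continuous γ) (hγg : ∀ t, γ t ∈ P.bmGood) :
    (∀ N : ℕ, IsClosed {t : ℝ | ∀ (μ : ℤ) (k : ℕ), Real.log (Real.exp 1 + |(μ : ℝ)|) < k →
      P.bmLocalEnergy μ k (γ t) / (2 * (k : ℝ) + 1) ≤ N}) ∧
    (∀ t : ℝ, ∃ N : ℕ, t ∈ {t : ℝ | ∀ (μ : ℤ) (k : ℕ), Real.log (Real.exp 1 + |(μ : ℝ)|) < k →
      P.bmLocalEnergy μ k (γ t) / (2 * (k : ℝ) + 1) ≤ N}) := by
  refine ⟨fun N => ?_, fun t => ?_⟩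
  · have : {t : ℝ | ∀ (μ : ℤ) (k : ℕ), Real.log (Real.exp 1 + |(μ : ℝ)|) < k →
        P.bmLocalEnergy μ k (γ t) / (2 * (k : ℝ) + 1) ≤ N} =
        ⋂ (μ : ℤ) (k : ℕ), {t | Real.log (Real.exp 1 + |(μ : ℝ)|) < k →
          P.bmLocalEnergy μ k (γ t) / (2 * (k : ℝ) + 1) ≤ N} := by
      ext t; simp
    rw [this]
    refine isClosed_iInter fun μ => isClosed_iInter fun k => ?_
    by_cases hk : Real.log (Real.exp 1 + |(μ : ℝ)|) < k
    · have hc : Continuous fun t => P.bmLocalEnergy μ k (γ t) / (2 * (k : ℝ) + 1) :=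
        (continuous_bmLocalEnergy_comp hUc hVc hγc μ k).div_const _
      simpa [hk] using isClosed_le hc continuous_const
    · simp [hk]
  · refine ⟨⌈P.bmGrowth (γ t)⌉₊, fun μ k hk => ?_⟩
    have h := bmLocalEnergy_le_of_lt (hγg t) hk
    have hpos : (0 : ℝ) < 2 * k + 1 := by positivity
    rw [div_le_iff₀ hpos]
    calc P.bmLocalEnergy μ k (γ t) ≤ P.bmGrowth (γ t) * (2 * k + 1) := h
      _ ≤ (⌈P.bmGrowth (γ t)⌉₊ : ℝ) * (2 * k + 1) := mul_le_mul_of_nonneg_right (Nat.le_ceil _) hpos.le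

/-- **Every time is a time of locally bounded `Q`** (Baire category): for a solution `γ` of (2.1) with
values in `𝒳₀`, the function `t ↦ Q(γ(t))` is locally bounded everywhere. The set of bad times is
closed; if non-empty it is a Baire space covered by the closed sublevel sets `{Q ∘ γ ≤ N}`, so
`Q ∘ γ ≤ N` on a relatively open piece of it; between bad times `γ` is transported by `Φ` (propagation
lemma), whose growth bound (2.7) then bounds `Q ∘ γ` near a bad time — a contradiction.
[cite: ButtaMarchioro2016, §2 Thm 2.1 (uniqueness)] -/
theorem good_everywhere (hs₁ : 1 ≤ s₁) (hs₂ : 1 ≤ s₂) (hU1 : IsEvenPolyOfDegree P.U s₁)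
    (hV1 : IsEvenPolyOfDegree P.V s₂) {Φ : ℝ → ChainConfig → ChainConfig}
    (hΦsol : ∀ y ∈ P.bmGood, P.IsSolution fun s => Φ s y) (hΦ0 : ∀ y ∈ P.bmGood, Φ 0 y = y)
    {G : ℝ → ℝ → ℝ} (hGmono : ∀ T T' q q', 0 ≤ T → T ≤ T' → 1 ≤ q → q ≤ q' → G T q ≤ G T' q')
    (hΦgrow : ∀ y ∈ P.bmGood, ∀ T : ℝ, 0 ≤ T → ∀ s, |s| ≤ T →
      Φ s y ∈ P.bmGood ∧ P.bmGrowth (Φ s y) ≤ G T (P.bmGrowth y))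
    (hgrp : ∀ t s : ℝ, ∀ y ∈ P.bmGood, Φ (t + s) y = Φ t (Φ s y))
    {γ : ℝ → ChainConfig} (hγ : P.IsSolution γ) (hγg : ∀ t, γ t ∈ P.bmGood) :
    ∀ t, ∃ ε > 0, ∃ N : ℝ, ∀ s, |s - t| < ε → P.bmGrowth (γ s) ≤ N := by
  have hU0 : ∀ r, 0 ≤ P.U r := hU1.choose_spec.2.2
  have hV0 : ∀ r, 0 ≤ P.V r := hV1.choose_spec.2.2
  have hUc : Continuous P.U := hU1.continuous
  have hVc : Continuous P.V := hV1.continuous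
  have hΦbd : ∀ y ∈ P.bmGood, ∀ T : ℝ, 0 ≤ T → ∃ N : ℝ, ∀ s, |s| ≤ T →
      Φ s y ∈ P.bmGood ∧ P.bmGrowth (Φ s y) ≤ N := fun y hy T hT => ⟨_, hΦgrow y hy T hT⟩
  have hcγ : Continuous γ := IsSolution.continuous_curve hγ
  obtain ⟨hAc, hAcov⟩ := isClosed_sublevel_bmGrowth hUc hVc hcγ hγg
  have hGood_open := isOpen_locallyBounded (fun s => P.bmGrowth (γ s))
  -- suppose the time `t` is bad
  intro t
  by_contra hbad
  have htB : t ∈ {t : ℝ | ∃ ε > 0, ∃ N : ℝ, ∀ s, |s - t| < ε → P.bmGrowth (γ s) ≤ N}ᶜ := hbad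
  obtain ⟨N, t₁, ht₁B, δ, hδ, hpiece⟩ := exists_baire_piece hGood_open.isClosed_compl htB hAc hAcov
  have hstar : ∀ t' ∈ {t : ℝ | ∃ ε > 0, ∃ N : ℝ, ∀ s, |s - t| < ε → P.bmGrowth (γ s) ≤ N}ᶜ,
      |t' - t₁| < δ → P.bmGrowth (γ t') ≤ N := fun t' ht' hd =>
    (mem_bmGood_of_le (hpiece t' ht' hd)).2
  -- we show that `t₁` is good: contradiction
  apply ht₁B
  refine ⟨δ / 2, by positivity, max (max (N : ℝ) 1) (G δ (max (N : ℝ) 1)), fun s hs => ?_⟩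
  by_cases hsB : s ∈ {t : ℝ | ∃ ε > 0, ∃ N : ℝ, ∀ s, |s - t| < ε → P.bmGrowth (γ s) ≤ N}ᶜ
  · exact ((hstar s hsB (by linarith)).trans (le_max_left _ _)).trans (le_max_left _ _)
  · have hsG : ∃ ε > 0, ∃ N : ℝ, ∀ s', |s' - s| < ε → P.bmGrowth (γ s') ≤ N := not_notMem.1 hsB
    obtain ⟨εs, hεs, Ns, hNs⟩ := hsG
    obtain ⟨c, hcB, hct₁, hsc, hside⟩ := exists_nearest_mem hGood_open.isClosed_compl ht₁B hsB
    -- `γ s = Φ_{s-c}(γ c)` by propagation along the good interval between `c` and `s`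
    have hγs : γ s = Φ (s - c) (γ c) := by
      -- the good interval `I` with `s ∈ I` and `c` an endpoint
      have hnear : ∀ t', |t' - s| < εs / 2 → ∃ ε > 0, ∃ N : ℝ, ∀ s', |s' - t'| < ε →
          P.bmGrowth (γ s') ≤ N := by
        intro t' ht'
        refine ⟨εs / 2, by positivity, Ns, fun s' hs' => hNs s' ?_⟩
        calc |s' - s| = |(s' - t') + (t' - s)| := by ring_nf
          _ ≤ |s' - t'| + |t' - s| := abs_add_le _ _
          _ < εs / 2 + εs / 2 := add_lt_add hs' ht'
          _ = εs := by ring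
      rcases hside with ⟨hcs, hI⟩ | ⟨hsc', hI⟩
      · have hsI : s ∈ Ioo c (s + εs / 2) := ⟨hcs, by linarith⟩
        have hgoodI : ∀ t' ∈ Ioo c (s + εs / 2), ∃ ε > 0, ∃ N : ℝ, ∀ s', |s' - t'| < ε →
            P.bmGrowth (γ s') ≤ N := by
          intro t' ht'
          by_cases h : t' < s
          · exact not_notMem.1 (hI t' ⟨ht'.1, h⟩)
          · have h' : s ≤ t' := not_lt.1 h
            exact hnear t' (by rw [abs_lt]; constructor <;> linarith [ht'.2])
        exact (flow_eq_on_good_interval hs₁ hs₂ hU1 hV1 hΦsol hΦ0 hΦbd hgrp hγ hγg hsI hgoodI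
          c ⟨le_rfl, by linarith⟩).2
      · have hsI : s ∈ Ioo (s - εs / 2) c := ⟨by linarith, hsc'⟩
        have hgoodI : ∀ t' ∈ Ioo (s - εs / 2) c, ∃ ε > 0, ∃ N : ℝ, ∀ s', |s' - t'| < ε →
            P.bmGrowth (γ s') ≤ N := by
          intro t' ht'
          by_cases h : s < t'
          · exact not_notMem.1 (hI t' ⟨h, ht'.2⟩)
          · have h' : t' ≤ s := not_lt.1 h
            exact hnear t' (by rw [abs_lt]; constructor <;> linarith [ht'.1])
        exact (flow_eq_on_good_interval hs₁ hs₂ hU1 hV1 hΦsol hΦ0 hΦbd hgrp hγ hγg hsI hgoodI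
          c ⟨by linarith, le_rfl⟩).2
    have hsc2 : |s - c| ≤ δ / 2 := hsc.trans hs.le
    have hct₁' : |c - t₁| < δ := lt_of_le_of_lt hct₁ (by linarith)
    have hQc : P.bmGrowth (γ c) ≤ N := hstar c hcB hct₁'
    have hQc1 : 1 ≤ P.bmGrowth (γ c) := one_le_bmGrowth hU0 hV0 (hγg c)
    have hg := (hΦgrow (γ c) (hγg c) (δ / 2) (by positivity) (s - c) hsc2).2
    rw [← hγs] at hg
    calc P.bmGrowth (γ s) ≤ G (δ / 2) (P.bmGrowth (γ c)) := hg
      _ ≤ G δ (max (N : ℝ) 1) := hGmono _ _ _ _ (by positivity) (by linarith) hQc1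
          (hQc.trans (le_max_left _ _))
      _ ≤ max (max (N : ℝ) 1) (G δ (max (N : ℝ) 1)) := le_max_right _ _

/-- **Uniqueness among `𝒳₀`-valued solutions**: a solution `γ` of (2.1) with `γ(0) = σ ∈ 𝒳₀` and
`γ(t) ∈ 𝒳₀` for all `t` is the orbit `t ↦ Φ_t(σ)` (every time is good by `good_everywhere`; the
agreement set is then clopen and contains `0`). [cite: ButtaMarchioro2016, §2 Thm 2.1 (uniqueness)] -/
theorem eq_flow_of_isSolution (hs₁ : 1 ≤ s₁) (hs₂ : 1 ≤ s₂) (hU1 : IsEvenPolyOfDegree P.U s₁)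
    (hV1 : IsEvenPolyOfDegree P.V s₂) {Φ : ℝ → ChainConfig → ChainConfig}
    (hΦsol : ∀ y ∈ P.bmGood, P.IsSolution fun s => Φ s y) (hΦ0 : ∀ y ∈ P.bmGood, Φ 0 y = y)
    {G : ℝ → ℝ → ℝ} (hGmono : ∀ T T' q q', 0 ≤ T → T ≤ T' → 1 ≤ q → q ≤ q' → G T q ≤ G T' q')
    (hΦgrow : ∀ y ∈ P.bmGood, ∀ T : ℝ, 0 ≤ T → ∀ s, |s| ≤ T →
      Φ s y ∈ P.bmGood ∧ P.bmGrowth (Φ s y) ≤ G T (P.bmGrowth y))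
    (hgrp : ∀ t s : ℝ, ∀ y ∈ P.bmGood, Φ (t + s) y = Φ t (Φ s y))
    {σ : ChainConfig} {γ : ℝ → ChainConfig} (hγ0 : γ 0 = σ)
    (hγ : P.IsSolution γ) (hγg : ∀ t, γ t ∈ P.bmGood) : ∀ t, γ t = Φ t σ := by
  have hΦbd : ∀ y ∈ P.bmGood, ∀ T : ℝ, 0 ≤ T → ∃ N : ℝ, ∀ s, |s| ≤ T →
      Φ s y ∈ P.bmGood ∧ P.bmGrowth (Φ s y) ≤ N := fun y hy T hT => ⟨_, hΦgrow y hy T hT⟩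
  have hgood := good_everywhere hs₁ hs₂ hU1 hV1 hΦsol hΦ0 hGmono hΦgrow hgrp hγ hγg
  intro t
  -- propagate from `t₀ = 0` along the good interval `(-|t|-1, |t|+1)`
  have h0I : (0 : ℝ) ∈ Ioo (-(|t| + 1)) (|t| + 1) := by
    constructor <;> linarith [abs_nonneg t]
  have key := flow_eq_on_good_interval hs₁ hs₂ hU1 hV1 hΦsol hΦ0 hΦbd hgrp hγ hγg h0I
    (fun t' _ => hgood t') t ⟨by linarith [neg_abs_le t], by linarith [le_abs_self t]⟩
  simpa [hγ0] using key.1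

/-- `Φ_0 = id` on `𝒳₀` for the limit flow (the severed flows at time `0` are the identity). [folklore] -/
theorem limit_flow_zero {hB1 : P.CondB1} {Φ : ℝ → ChainConfig → ChainConfig}
    (hΦ : ∀ x ∈ P.bmGood, ∀ (s : ℝ) (i : ℤ),
      Tendsto (fun n : ℕ => severedFlow hB1 (Finset.Icc ((0 : ℤ) - n) ((0 : ℤ) + n)) s x i) atTop
        (𝓝 (Φ s x i)))
    {y : ChainConfig} (hy : y ∈ P.bmGood) : Φ 0 y = y := by
  funext i
  have h := hΦ y hy 0 i
  simp only [severedFlow_zero] at h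
  exact tendsto_nhds_unique h tendsto_const_nhds

/-- **Buttà–Marchioro 2016, Theorem 2.1, for `d = ν = 1` — proved.** Discharges the named fact
`ButtaMarchioro2016_thm21_chain`. The flow `Φ_t(x)` is the limit (3.3) of the severed (partial)
dynamics in the boxes `Λ_{0,n}` (`exists_limit_flow`; independent of the centre,
`tendsto_severedFlow_cbox`); it solves (2.1) (`isSolution_limit`), satisfies the growth bound (2.7)
and maps `𝒳₀` to itself (`growth_bound`); the group law and the uniqueness among `𝒳₀`-valued solutions
follow from uniqueness in the locally-bounded-`Q` class (`eq_of_isSolution_of_bmGrowth_le`, the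
Dobrushin–Fritz iteration) upgraded by a Baire-category argument (`good_everywhere`,
`eq_flow_of_isSolution`). [cite: ButtaMarchioro2016, §2 Thm 2.1 and §3] -/
theorem ButtaMarchioro2016_thm21_chain_holds : ButtaMarchioro2016_thm21_chain := by
  intro P s₁ s₂ hs₁ hs₂ hU1 hV1
  have hU : ContDiff ℝ 2 P.U := hU1.contDiff_two
  have hV : ContDiff ℝ 2 P.V := hV1.contDiff_two
  have hU0 : ∀ r, 0 ≤ P.U r := hU1.choose_spec.2.2
  have hV0 : ∀ r, 0 ≤ P.V r := hV1.choose_spec.2.2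
  have hB1 : P.CondB1 := condB1_of_bddBelow P hU hV
    ⟨0, by rintro _ ⟨q, rfl⟩; exact hU0 q⟩ ⟨0, by rintro _ ⟨r, rfl⟩; exact hV0 r⟩
  obtain ⟨Φ, hΦ⟩ := exists_limit_flow hs₁ hs₂ hU1 hV1 hB1
  -- a fixed admissible pair `(γ₀, 1)` for the qualitative uses of (2.7)
  have hS1 : (1 : ℝ) ≤ ((max s₁ s₂ : ℕ) : ℝ) := by exact_mod_cast le_max_of_le_left hs₁
  have hS0 : (0 : ℝ) < ((max s₁ s₂ : ℕ) : ℝ) := by linarith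
  have hη1 : (((max s₁ s₂ : ℕ) : ℝ) - 1) / ((max s₁ s₂ : ℕ) : ℝ) ≤ 1 := by
    rw [div_le_one hS0]; linarith
  have hη0 : 0 ≤ (((max s₁ s₂ : ℕ) : ℝ) - 1) / ((max s₁ s₂ : ℕ) : ℝ) :=
    div_nonneg (by linarith) hS0.le
  have hγ₀ : (((max s₁ s₂ : ℕ) : ℝ) - 1) / ((max s₁ s₂ : ℕ) : ℝ) <
      ((((max s₁ s₂ : ℕ) : ℝ) - 1) / ((max s₁ s₂ : ℕ) : ℝ) + 2) / 2 := by linarith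
  have hγ₀2 : ((((max s₁ s₂ : ℕ) : ℝ) - 1) / ((max s₁ s₂ : ℕ) : ℝ) + 2) / 2 < 2 := by linarith
  obtain ⟨Cg, hCg0, hgrow₀⟩ := growth_bound hs₁ hs₂ hU1 hV1 hB1 hΦ hγ₀ hγ₀2 one_pos
  -- abbreviations for the exponents of the fixed majorant
  obtain ⟨a, ha⟩ : ∃ a : ℝ, a = 2 / (2 - ((((max s₁ s₂ : ℕ) : ℝ) - 1) / ((max s₁ s₂ : ℕ) : ℝ) + 2) / 2) :=
    ⟨_, rfl⟩
  obtain ⟨b, hb⟩ : ∃ b : ℝ, b = (((((max s₁ s₂ : ℕ) : ℝ) - 1) / ((max s₁ s₂ : ℕ) : ℝ) + 2) / 2) /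
      (2 - ((((max s₁ s₂ : ℕ) : ℝ) - 1) / ((max s₁ s₂ : ℕ) : ℝ) + 2) / 2) := ⟨_, rfl⟩
  have ha0 : 0 ≤ a := by rw [ha]; exact div_nonneg (by norm_num) (by linarith)
  have hb0 : 0 ≤ b := by rw [hb]; exact div_nonneg (by linarith) (by linarith)
  rw [← ha, ← hb] at hgrow₀
  have hΦgrow : ∀ y ∈ P.bmGood, ∀ T : ℝ, 0 ≤ T → ∀ s, |s| ≤ T → Φ s y ∈ P.bmGood ∧
      P.bmGrowth (Φ s y) ≤ (fun T q => Cg * q * (1 + T ^ a * (1 + T ^ (1 : ℝ)) * q ^ b)) T (P.bmGrowth y) :=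
    fun y hy T hT s hs => hgrow₀ y hy T hT s hs
  have hGmono : ∀ T T' q q' : ℝ, 0 ≤ T → T ≤ T' → 1 ≤ q → q ≤ q' →
      (fun T q => Cg * q * (1 + T ^ a * (1 + T ^ (1 : ℝ)) * q ^ b)) T q ≤
        (fun T q => Cg * q * (1 + T ^ a * (1 + T ^ (1 : ℝ)) * q ^ b)) T' q' := by
    intro T T' q q' hT hTT' hq hqq'
    have hq0 : 0 ≤ q := by linarith
    have hq'0 : 0 ≤ q' := by linarith
    have hT' : 0 ≤ T' := hT.trans hTT'
    have hCg : 0 ≤ Cg := hCg0.le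
    have h1 : T ^ a ≤ T' ^ a := Real.rpow_le_rpow hT hTT' ha0
    have h2 : T ^ (1 : ℝ) ≤ T' ^ (1 : ℝ) := Real.rpow_le_rpow hT hTT' zero_le_one
    have h3 : q ^ b ≤ q' ^ b := Real.rpow_le_rpow hq0 hqq' hb0
    have h4 : 0 ≤ T' ^ a := Real.rpow_nonneg hT' a
    have h5 : 0 ≤ T' ^ (1 : ℝ) := Real.rpow_nonneg hT' 1
    have h6 : 0 ≤ q' ^ b := Real.rpow_nonneg hq'0 b
    have h7 : 0 ≤ T ^ a := Real.rpow_nonneg hT a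
    have h8 : 0 ≤ T ^ (1 : ℝ) := Real.rpow_nonneg hT 1
    have h9 : 0 ≤ q ^ b := Real.rpow_nonneg hq0 b
    show Cg * q * (1 + T ^ a * (1 + T ^ (1 : ℝ)) * q ^ b) ≤ Cg * q' * (1 + T' ^ a * (1 + T' ^ (1 : ℝ)) * q' ^ b)
    have hx : T ^ a * (1 + T ^ (1 : ℝ)) * q ^ b ≤ T' ^ a * (1 + T' ^ (1 : ℝ)) * q' ^ b := by
      calc T ^ a * (1 + T ^ (1 : ℝ)) * q ^ b ≤ T' ^ a * (1 + T ^ (1 : ℝ)) * q ^ b := by gcongr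
        _ ≤ T' ^ a * (1 + T' ^ (1 : ℝ)) * q ^ b := by gcongr
        _ ≤ T' ^ a * (1 + T' ^ (1 : ℝ)) * q' ^ b := by gcongr
    have hy : 0 ≤ 1 + T ^ a * (1 + T ^ (1 : ℝ)) * q ^ b := by positivity
    calc Cg * q * (1 + T ^ a * (1 + T ^ (1 : ℝ)) * q ^ b)
        ≤ Cg * q' * (1 + T ^ a * (1 + T ^ (1 : ℝ)) * q ^ b) := by gcongr
      _ ≤ Cg * q' * (1 + T' ^ a * (1 + T' ^ (1 : ℝ)) * q' ^ b) := by gcongr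
  -- the structural properties of `Φ`
  have hΦsol : ∀ y ∈ P.bmGood, P.IsSolution fun s => Φ s y := fun y hy =>
    isSolution_limit hs₁ hs₂ hU1 hV1 hB1 hΦ hy
  have hΦ0 : ∀ y ∈ P.bmGood, Φ 0 y = y := fun y hy => limit_flow_zero hΦ hy
  have hΦbd : ∀ y ∈ P.bmGood, ∀ T : ℝ, 0 ≤ T → ∃ N : ℝ, ∀ s, |s| ≤ T →
      Φ s y ∈ P.bmGood ∧ P.bmGrowth (Φ s y) ≤ N := fun y hy T hT => ⟨_, hΦgrow y hy T hT⟩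
  have hgrp : ∀ t s : ℝ, ∀ y ∈ P.bmGood, Φ (t + s) y = Φ t (Φ s y) := fun t s y hy =>
    flow_add_of_bounds hs₁ hs₂ hU1 hV1 hΦsol hΦ0 hΦbd t s hy
  refine ⟨Φ, fun t y hy => (hΦgrow y hy |t| (abs_nonneg t) t le_rfl).1, hΦ0, hgrp, hΦsol, ?_, ?_⟩
  · -- uniqueness among `𝒳₀`-valued solutions
    intro σ _ γ hγ0 hγ hγg t
    exact eq_flow_of_isSolution hs₁ hs₂ hU1 hV1 hΦsol hΦ0 hGmono hΦgrow hgrp hγ0 hγ hγg t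
  · -- the growth estimate (2.7)
    intro γ' hγ' hγ'2 β' hβ'
    obtain ⟨C, hC, hgb⟩ := growth_bound hs₁ hs₂ hU1 hV1 hB1 hΦ hγ' hγ'2 hβ'
    refine ⟨C, hC, fun t ht σ hσ => ?_⟩
    exact (hgb σ hσ t ht.le t (by rw [abs_of_pos ht])).2

end Assembly

end OscillatorChain

end Literature.MathematicalPhysics.KineticTheory.HeatConduction

end

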